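import Literature.Computability.MetaComplexity.EFModAddULaws
import HarnessLib

/-!
# Associativity of uniform modular addition in extended Frege

Layer D (uniform variant), part 3: `(a ⊕ b) ⊕ c = a ⊕ (b ⊕ c)` for the modular adder
`ModAddU.modAddT`, as a polynomial-size block (`ModAddU.AssocData.isBlock_lines`,
conclusion `AssocData.mem_lines`). Setting: four modular adders `M₁ = a ⊕ b`, `M₂ = M₁ ⊕ c`,
`M₃ = b ⊕ c`, `M₄ = a ⊕ M₃` of width `L`, operands equal to the zero variable from position
`m` on (`m + 2 ≤ L`), `a < n` and `c < n`; plus scratch circuits (`AssocData`: the sum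
`Y = S₁ + c`, its reductions `E1`, `y1s`, `E2s`, the two reduction paths `y1T, E2T, wT` and
`y1V, E2V, wV` selected by the actual comparison bits, and `AU = a + S₃`, `EAU`, `zV`).

## Proof architecture (position-uniform; no case analysis on operand bits)

Writing `x ⊖_g n` for `g ? x - n : x`:
1. `S₂ = s' + c ≡ (S₁ + c) ⊖_{ge₁} n` (system `SAC`) and `S₄ = a + u' ≡ (a + S₃) ⊖_{ge₃} n`
   (system `SACL`); `S₁ + c ≡ a + S₃` (system `AU`, associativity of plain addition on one
   width); hence by congruence `t' ≡ wT := ((Y ⊖_{ge₁} n) ⊖_{ge₂} n)` and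
   `v' ≡ wV := ((Y ⊖_{ge₃} n) ⊖_{ge₄} n)`.
2. `wT ≡ wV` at every position provided `ge₁ + ge₂ = ge₃ + ge₄` (system `B4`).
3. The count: with `g₁ = [Y ≥ n]`, `g₂ = [Y ⊖_{g₁} n ≥ n]`, both `ge₁ + ge₂` and `ge₃ + ge₄`
   equal `g₁ + g₂` — by a binary case split on `ge₁` (resp. `ge₃`): in the negative case
   `ge₂ ↔ g₁` by congruence and `¬g₂` by the end rule of system `NG2` (`Y < 2n`); in the
   positive case `g₁` by the end rule of `G1` and `ge₂ ↔ g₂` by congruence.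
Every system's invariant is the machine-found set of reachable carry states; all 24 generated
rules and the 6 glue rules are verified sound by `decide`. Generic tools of independent use:
`ModAddU.posBlock` (induction + per-position conclusions), `ModAddU.isBlock_flatten`
(segmented blocks), `ModAddU.subDefList` / `muxDefList` (weakening availability into a case
context).

## Sources

* S. A. Cook, R. A. Reckhow, *The relative efficiency of propositional proof systems*,
  J. Symbolic Logic 44 (1979), §2 (sound schematic rules).
* J. Krajíček, *Bounded Arithmetic, Propositional Logic, and Complexity Theory* (CUP 1995),
  §9.2 (the laws of arithmetic on binary numerals in `EF`; constructed here directly).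
-/

namespace Literature.Computability.MetaComplexity

open _root_.Computability Complexity Complexity.PropForm Netlist Cluster

namespace ModAddU

/-! ### The carry systems of associativity (generated: `work/assoc_gen.py`) -/

/-- **System `SAC`**: `(x ⊖_g n) + c` versus `(x + c) ⊖_g n` — the sum bit `t` of the adder on the reduced word equals the bit `w` of the reduced sum, at every position.
Leaves: 1 gm, 2 tau, 3 eta, 4 eps, 5 g, 6 x, 7 c, 8 n; defined: 9 nD, 10 d, 11 gm2, 12 sp, 13 t, 14 tau2, 15 y, 16 eta2, 17 nE, 18 dy, 19 eps2, 20 w. Invariant: the reachable carry states (8 terms). [folklore] -/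
def SAC : System where
  cins := [biimp (var 1) (const true), biimp (var 2) (const false), biimp (var 3) (const false), biimp (var 4) (const true)]
  shapes := [biimp (var 9) (neg (var 8)),
    biimp (var 10) (xor3F (var 6) (var 9) (var 1)),
    biimp (var 11) (majF (var 6) (var 9) (var 1)),
    biimp (var 12) (muxF (var 5) (var 10) (var 6)),
    biimp (var 13) (xor3F (var 12) (var 7) (var 2)),
    biimp (var 14) (majF (var 12) (var 7) (var 2)),
    biimp (var 15) (xor3F (var 6) (var 7) (var 3)),
    biimp (var 16) (majF (var 6) (var 7) (var 3)),
    biimp (var 17) (neg (var 8)),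
    biimp (var 18) (xor3F (var 15) (var 17) (var 4)),
    biimp (var 19) (majF (var 15) (var 17) (var 4)),
    biimp (var 20) (muxF (var 5) (var 18) (var 15))]
  inv := (disj (disj (disj (conj (conj (neg (var 1)) (neg (var 2))) (conj (neg (var 3)) (neg (var 4)))) (conj (conj (neg (var 1)) (neg (var 2))) (conj (neg (var 3)) (neg (var 5))))) (disj (conj (conj (neg (var 1)) (var 2)) (conj (neg (var 3)) (conj (var 4) (var 5)))) (conj (conj (neg (var 1)) (var 2)) (conj (var 3) (neg (var 4)))))) (disj (disj (conj (conj (var 1) (neg (var 2))) (conj (neg (var 3)) (var 4))) (conj (conj (var 1) (neg (var 2))) (conj (var 3) (conj (neg (var 4)) (var 5))))) (disj (conj (conj (var 1) (var 2)) (conj (var 3) (var 4))) (conj (conj (var 2) (var 3)) (conj (neg (var 4)) (neg (var 5)))))))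
  next := fun k => if k = 1 then 11 else if k = 2 then 14 else if k = 3 then 16 else if k = 4 then 19 else k

/-- Per-position rule of `SAC`. [cite: CookReckhow1979, §2 (sound rule)] -/
def rSACPos : FregeRule := SAC.endRule SAC.shapes (biimp (var 13) (var 20))

/-- **System `SACL`**: `c + (x ⊖_g n)` versus `(c + x) ⊖_g n` (the mirror of `SAC`, addend on the left).
Leaves: 1 gm, 2 tau, 3 eta, 4 eps, 5 g, 6 x, 7 c, 8 n; defined: 9 nD, 10 d, 11 gm2, 12 sp, 13 t, 14 tau2, 15 y, 16 eta2, 17 nE, 18 dy, 19 eps2, 20 w. Invariant: the reachable carry states (8 terms). [folklore] -/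
def SACL : System where
  cins := [biimp (var 1) (const true), biimp (var 2) (const false), biimp (var 3) (const false), biimp (var 4) (const true)]
  shapes := [biimp (var 9) (neg (var 8)),
    biimp (var 10) (xor3F (var 6) (var 9) (var 1)),
    biimp (var 11) (majF (var 6) (var 9) (var 1)),
    biimp (var 12) (muxF (var 5) (var 10) (var 6)),
    biimp (var 13) (xor3F (var 7) (var 12) (var 2)),
    biimp (var 14) (majF (var 7) (var 12) (var 2)),
    biimp (var 15) (xor3F (var 7) (var 6) (var 3)),
    biimp (var 16) (majF (var 7) (var 6) (var 3)),
    biimp (var 17) (neg (var 8)),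
    biimp (var 18) (xor3F (var 15) (var 17) (var 4)),
    biimp (var 19) (majF (var 15) (var 17) (var 4)),
    biimp (var 20) (muxF (var 5) (var 18) (var 15))]
  inv := (disj (disj (disj (conj (conj (neg (var 1)) (neg (var 2))) (conj (neg (var 3)) (neg (var 4)))) (conj (conj (neg (var 1)) (neg (var 2))) (conj (neg (var 3)) (neg (var 5))))) (disj (conj (conj (neg (var 1)) (var 2)) (conj (neg (var 3)) (conj (var 4) (var 5)))) (conj (conj (neg (var 1)) (var 2)) (conj (var 3) (neg (var 4)))))) (disj (disj (conj (conj (var 1) (neg (var 2))) (conj (neg (var 3)) (var 4))) (conj (conj (var 1) (neg (var 2))) (conj (var 3) (conj (neg (var 4)) (var 5))))) (disj (conj (conj (var 1) (var 2)) (conj (var 3) (var 4))) (conj (conj (var 2) (var 3)) (conj (neg (var 4)) (neg (var 5)))))))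
  next := fun k => if k = 1 then 11 else if k = 2 then 14 else if k = 3 then 16 else if k = 4 then 19 else k

/-- Per-position rule of `SACL`. [cite: CookReckhow1979, §2 (sound rule)] -/
def rSACLPos : FregeRule := SACL.endRule SACL.shapes (biimp (var 13) (var 20))

/-- **System `AU`**: `(u + v) + z` versus `u + (v + z)` on words of one width (sum bits only): equal sum bits at every position.
Leaves: 1 cA, 2 cB, 3 cC, 4 cD, 5 u, 6 v, 7 z; defined: 8 sA, 9 cA2, 10 sB, 11 cB2, 12 sC, 13 cC2, 14 sD, 15 cD2. Invariant: the reachable carry states (6 terms). [folklore] -/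
def AU : System where
  cins := [biimp (var 1) (const false), biimp (var 2) (const false), biimp (var 3) (const false), biimp (var 4) (const false)]
  shapes := [biimp (var 8) (xor3F (var 5) (var 6) (var 1)),
    biimp (var 9) (majF (var 5) (var 6) (var 1)),
    biimp (var 10) (xor3F (var 8) (var 7) (var 2)),
    biimp (var 11) (majF (var 8) (var 7) (var 2)),
    biimp (var 12) (xor3F (var 6) (var 7) (var 3)),
    biimp (var 13) (majF (var 6) (var 7) (var 3)),
    biimp (var 14) (xor3F (var 5) (var 12) (var 4)),
    biimp (var 15) (majF (var 5) (var 12) (var 4))]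
  inv := (disj (disj (conj (conj (neg (var 1)) (neg (var 2))) (conj (neg (var 3)) (neg (var 4)))) (disj (conj (conj (neg (var 1)) (var 2)) (conj (neg (var 3)) (var 4))) (conj (conj (neg (var 1)) (var 2)) (conj (var 3) (neg (var 4)))))) (disj (conj (conj (var 1) (neg (var 2))) (conj (neg (var 3)) (var 4))) (disj (conj (conj (var 1) (neg (var 2))) (conj (var 3) (neg (var 4)))) (conj (conj (var 1) (var 2)) (conj (var 3) (var 4))))))
  next := fun k => if k = 1 then 9 else if k = 2 then 11 else if k = 3 then 13 else if k = 4 then 15 else k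

/-- Per-position rule of `AU`. [cite: CookReckhow1979, §2 (sound rule)] -/
def rAUPos : FregeRule := AU.endRule AU.shapes (biimp (var 10) (var 14))

/-- **System `B4`**: `(y ⊖_{g₁} n) ⊖_{g₂} n` versus `(y ⊖_{g₃} n) ⊖_{g₄} n` — equal at every position whenever `g₁ + g₂ = g₃ + g₄`.
Leaves: 1 e1, 2 e2T, 3 e2V, 4 g1, 5 g2, 6 g3, 7 g4, 8 y, 9 n; defined: 10 nE1, 11 dy, 12 e1n, 13 y1T, 14 nT, 15 d2T, 16 e2Tn, 17 wT, 18 y1V, 19 nV, 20 d2V, 21 e2Vn, 22 wV. Invariant: the reachable carry states (8 terms). [folklore] -/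
def B4 : System where
  cins := [biimp (var 1) (const true), biimp (var 2) (const true), biimp (var 3) (const true)]
  shapes := [biimp (var 10) (neg (var 9)),
    biimp (var 11) (xor3F (var 8) (var 10) (var 1)),
    biimp (var 12) (majF (var 8) (var 10) (var 1)),
    biimp (var 13) (muxF (var 4) (var 11) (var 8)),
    biimp (var 14) (neg (var 9)),
    biimp (var 15) (xor3F (var 13) (var 14) (var 2)),
    biimp (var 16) (majF (var 13) (var 14) (var 2)),
    biimp (var 17) (muxF (var 5) (var 15) (var 13)),
    biimp (var 18) (muxF (var 6) (var 11) (var 8)),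
    biimp (var 19) (neg (var 9)),
    biimp (var 20) (xor3F (var 18) (var 19) (var 3)),
    biimp (var 21) (majF (var 18) (var 19) (var 3)),
    biimp (var 22) (muxF (var 7) (var 20) (var 18))]
  inv := (disj (disj (disj (conj (conj (neg (var 1)) (neg (var 2))) (conj (neg (var 4)) (var 6))) (conj (conj (neg (var 1)) (neg (var 3))) (conj (var 4) (neg (var 6))))) (disj (conj (conj (neg (var 2)) (neg (var 3))) (conj (var 4) (var 6))) (conj (conj (var 1) (var 2)) (conj (neg (var 4)) (var 6))))) (disj (disj (conj (conj (var 1) (var 3)) (conj (var 4) (neg (var 6)))) (conj (conj (var 2) (var 3)) (conj (var 4) (var 6)))) (disj (conj (neg (var 1)) (conj (neg (var 2)) (neg (var 3)))) (conj (var 1) (conj (var 2) (var 3))))))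
  next := fun k => if k = 1 then 12 else if k = 2 then 16 else if k = 3 then 21 else k

/-- `g₁ + g₂ = g₃ + g₄` as a formula over the parameter leaves of `B4`. [folklore] -/
def validB4 : PropForm ℕ := (conj (biimp (biimp (var 4) (var 5)) (biimp (var 6) (var 7))) (biimp (conj (var 4) (var 5)) (conj (var 6) (var 7))))

/-- Per-position rule of `B4`. [cite: CookReckhow1979, §2 (sound rule)] -/
def rB4Pos : FregeRule := B4.endRule (validB4 :: B4.shapes) (biimp (var 17) (var 22))

/-- **System `NG2`**: with `s, c < n` and `g₁ = [s + c ≥ n]`, the once-reduced sum `y₁ = (s + c) ⊖_{g₁} n` is `< n` (end rule).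
Leaves: 1 ka, 2 gm, 3 eta, 4 e1, 5 e2, 6 g1, 7 s, 8 c, 9 n; defined: 10 nC, 11 ka2, 12 nD, 13 gm2, 14 y, 15 eta2, 16 nE1, 17 dy, 18 e1n, 19 y1, 20 nE2, 21 e2n. Invariant: the reachable carry states (12 terms). [folklore] -/
def NG2 : System where
  cins := [biimp (var 1) (const true), biimp (var 2) (const true), biimp (var 3) (const false), biimp (var 4) (const true), biimp (var 5) (const true)]
  shapes := [biimp (var 10) (neg (var 9)),
    biimp (var 11) (majF (var 8) (var 10) (var 1)),
    biimp (var 12) (neg (var 9)),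
    biimp (var 13) (majF (var 7) (var 12) (var 2)),
    biimp (var 14) (xor3F (var 7) (var 8) (var 3)),
    biimp (var 15) (majF (var 7) (var 8) (var 3)),
    biimp (var 16) (neg (var 9)),
    biimp (var 17) (xor3F (var 14) (var 16) (var 4)),
    biimp (var 18) (majF (var 14) (var 16) (var 4)),
    biimp (var 19) (muxF (var 6) (var 17) (var 14)),
    biimp (var 20) (neg (var 9)),
    biimp (var 21) (majF (var 19) (var 20) (var 5))]
  inv := (disj (disj (disj (conj (conj (neg (var 1)) (neg (var 2))) (conj (neg (var 3)) (conj (neg (var 4)) (var 6)))) (disj (conj (conj (neg (var 1)) (neg (var 2))) (conj (neg (var 4)) (neg (var 5)))) (conj (conj (neg (var 1)) (neg (var 3))) (conj (var 4) (conj (neg (var 5)) (var 6)))))) (disj (conj (conj (neg (var 1)) (var 2)) (conj (var 3) (conj (neg (var 4)) (var 6)))) (disj (conj (conj (neg (var 3)) (var 4)) (conj (var 5) (neg (var 6)))) (conj (conj (var 1) (neg (var 2))) (conj (neg (var 3)) (conj (var 4) (var 6))))))) (disj (disj (conj (conj (var 1) (neg (var 2))) (conj (var 3) (conj (neg (var 4))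 (var 6)))) (disj (conj (conj (var 1) (var 2)) (conj (var 3) (conj (var 4) (var 6)))) (conj (conj (var 1) (var 2)) (conj (var 4) (var 5))))) (disj (conj (conj (var 1) (var 3)) (conj (neg (var 4)) (conj (var 5) (var 6)))) (disj (conj (conj (var 2) (neg (var 3))) (conj (var 4) (var 5))) (conj (conj (var 3) (neg (var 4))) (conj (neg (var 5)) (neg (var 6))))))))
  next := fun k => if k = 1 then 11 else if k = 2 then 13 else if k = 3 then 15 else if k = 4 then 18 else if k = 5 then 21 else k

/-- End rule of `NG2`: `¬κ`, `¬γ`, `g₁ ↔ ε₁` give `¬ε₂`. [cite: CookReckhow1979, §2 (sound rule)] -/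
def rNG2End : FregeRule := NG2.endRule [neg (var 1), neg (var 2), biimp (var 6) (var 4)] (neg (var 5))

/-- **System `NG2L`**: the mirror of `NG2` for the adder `c + s`.
Leaves: 1 ka, 2 gm, 3 eta, 4 e1, 5 e2, 6 g1, 7 s, 8 c, 9 n; defined: 10 nC, 11 ka2, 12 nD, 13 gm2, 14 au, 15 y, 16 eta2, 17 nE1, 18 dy, 19 e1n, 20 y1, 21 nE2, 22 e2n. Invariant: the reachable carry states (12 terms). [folklore] -/
def NG2L : System where
  cins := [biimp (var 1) (const true), biimp (var 2) (const true), biimp (var 3) (const false), biimp (var 4) (const true), biimp (var 5) (const true)]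
  shapes := [biimp (var 10) (neg (var 9)),
    biimp (var 11) (majF (var 8) (var 10) (var 1)),
    biimp (var 12) (neg (var 9)),
    biimp (var 13) (majF (var 7) (var 12) (var 2)),
    biimp (var 14) (xor3F (var 8) (var 7) (var 3)),
    biimp (var 15) (var 14),
    biimp (var 16) (majF (var 8) (var 7) (var 3)),
    biimp (var 17) (neg (var 9)),
    biimp (var 18) (xor3F (var 15) (var 17) (var 4)),
    biimp (var 19) (majF (var 15) (var 17) (var 4)),
    biimp (var 20) (muxF (var 6) (var 18) (var 15)),
    biimp (var 21) (neg (var 9)),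
    biimp (var 22) (majF (var 20) (var 21) (var 5))]
  inv := (disj (disj (disj (conj (conj (neg (var 1)) (neg (var 2))) (conj (neg (var 3)) (conj (neg (var 4)) (var 6)))) (disj (conj (conj (neg (var 1)) (neg (var 2))) (conj (neg (var 4)) (neg (var 5)))) (conj (conj (neg (var 1)) (neg (var 3))) (conj (var 4) (conj (neg (var 5)) (var 6)))))) (disj (conj (conj (neg (var 1)) (var 2)) (conj (var 3) (conj (neg (var 4)) (var 6)))) (disj (conj (conj (neg (var 3)) (var 4)) (conj (var 5) (neg (var 6)))) (conj (conj (var 1) (neg (var 2))) (conj (neg (var 3)) (conj (var 4) (var 6))))))) (disj (disj (conj (conj (var 1) (neg (var 2))) (conj (var 3) (conj (neg (var 4)) (var 6)))) (disj (conj (conj (var 1) (var 2)) (conj (var 3) (conj (var 4) (var 6)))) (conj (conj (var 1) (var 2)) (conj (var 4) (var 5))))) (disj (conj (conj (var 1) (var 3)) (conj (neg (var 4)) (conj (var 5) (var 6)))) (disj (conj (conj (var 2) (neg (var 3))) (conj (var 4) (var 5))) (conj (conj (var 3) (neg (var 4))) (conj (neg (var 5)) (neg (var 6))))))))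
  next := fun k => if k = 1 then 11 else if k = 2 then 13 else if k = 3 then 16 else if k = 4 then 19 else if k = 5 then 22 else k

/-- End rule of `NG2L`. [cite: CookReckhow1979, §2 (sound rule)] -/
def rNG2LEnd : FregeRule := NG2L.endRule [neg (var 1), neg (var 2), biimp (var 6) (var 4)] (neg (var 5))

/-- **System `G1`**: with `s ≥ n` and no overflow of `s + c`, also `s + c ≥ n` (end rule).
Leaves: 1 gm, 2 eta, 3 e1, 4 s, 5 c, 6 n; defined: 7 nD, 8 gm2, 9 y, 10 eta2, 11 nE1, 12 e1n. Invariant: the reachable carry states (3 terms). [folklore] -/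
def G1 : System where
  cins := [biimp (var 1) (const true), biimp (var 2) (const false), biimp (var 3) (const true)]
  shapes := [biimp (var 7) (neg (var 6)),
    biimp (var 8) (majF (var 4) (var 7) (var 1)),
    biimp (var 9) (xor3F (var 4) (var 5) (var 2)),
    biimp (var 10) (majF (var 4) (var 5) (var 2)),
    biimp (var 11) (neg (var 6)),
    biimp (var 12) (majF (var 9) (var 11) (var 3))]
  inv := (disj (conj (neg (var 1)) (neg (var 3))) (disj (conj (neg (var 2)) (var 3)) (conj (var 1) (var 2))))
  next := fun k => if k = 1 then 8 else if k = 2 then 10 else if k = 3 then 12 else k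

/-- End rule of `G1`: `γ`, `¬η` give `ε₁`. [cite: CookReckhow1979, §2 (sound rule)] -/
def rG1End : FregeRule := G1.endRule [var 1, neg (var 2)] (var 3)

/-- **System `G1L`**: the mirror of `G1` for the adder `c + s`.
Leaves: 1 gm, 2 eta, 3 e1, 4 s, 5 c, 6 n; defined: 7 nD, 8 gm2, 9 au, 10 y, 11 eta2, 12 nE1, 13 e1n. Invariant: the reachable carry states (3 terms). [folklore] -/
def G1L : System where
  cins := [biimp (var 1) (const true), biimp (var 2) (const false), biimp (var 3) (const true)]
  shapes := [biimp (var 7) (neg (var 6)),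
    biimp (var 8) (majF (var 4) (var 7) (var 1)),
    biimp (var 9) (xor3F (var 5) (var 4) (var 2)),
    biimp (var 10) (var 9),
    biimp (var 11) (majF (var 5) (var 4) (var 2)),
    biimp (var 12) (neg (var 6)),
    biimp (var 13) (majF (var 10) (var 12) (var 3))]
  inv := (disj (conj (neg (var 1)) (neg (var 3))) (disj (conj (neg (var 2)) (var 3)) (conj (var 1) (var 2))))
  next := fun k => if k = 1 then 8 else if k = 2 then 11 else if k = 3 then 13 else k

/-- End rule of `G1L`. [cite: CookReckhow1979, §2 (sound rule)] -/
def rG1LEnd : FregeRule := G1L.endRule [var 1, neg (var 2)] (var 3)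

/-- The rules of the associativity layer. [cite: CookReckhow1979, §2] -/
def assocRules : List FregeRule :=
  [SAC.baseRule, SAC.stepRule, rSACPos, SACL.baseRule, SACL.stepRule, rSACLPos, AU.baseRule, AU.stepRule, rAUPos,
    B4.baseRule, B4.stepRule, rB4Pos, NG2.baseRule, NG2.stepRule, rNG2End, NG2L.baseRule, NG2L.stepRule, rNG2LEnd,
    G1.baseRule, G1.stepRule, rG1End, G1L.baseRule, G1L.stepRule, rG1LEnd]

/-- Soundness check. [cite: CookReckhow1979, §2 (sound rule)] -/
theorem check_SAC_base : SAC.baseRule.check = true := by decide +kernel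
/-- Soundness check. [cite: CookReckhow1979, §2 (sound rule)] -/
theorem check_SAC_step : SAC.stepRule.checkD 9 SAC.ds = true := by decide +kernel
/-- Soundness check. [cite: CookReckhow1979, §2 (sound rule)] -/
theorem check_SAC_pos : rSACPos.checkD 9 SAC.ds = true := by decide +kernel
/-- Soundness check. [cite: CookReckhow1979, §2 (sound rule)] -/
theorem check_SACL_base : SACL.baseRule.check = true := by decide +kernel
/-- Soundness check. [cite: CookReckhow1979, §2 (sound rule)] -/
theorem check_SACL_step : SACL.stepRule.checkD 9 SACL.ds = true := by decide +kernel
/-- Soundness check. [cite: CookReckhow1979, §2 (sound rule)] -/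
theorem check_SACL_pos : rSACLPos.checkD 9 SACL.ds = true := by decide +kernel
/-- Soundness check. [cite: CookReckhow1979, §2 (sound rule)] -/
theorem check_AU_base : AU.baseRule.check = true := by decide +kernel
/-- Soundness check. [cite: CookReckhow1979, §2 (sound rule)] -/
theorem check_AU_step : AU.stepRule.checkD 8 AU.ds = true := by decide +kernel
/-- Soundness check. [cite: CookReckhow1979, §2 (sound rule)] -/
theorem check_AU_pos : rAUPos.checkD 8 AU.ds = true := by decide +kernel
/-- Soundness check. [cite: CookReckhow1979, §2 (sound rule)] -/
theorem check_B4_base : B4.baseRule.check = true := by decide +kernel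
/-- Soundness check. [cite: CookReckhow1979, §2 (sound rule)] -/
theorem check_B4_step : B4.stepRule.checkD 10 B4.ds = true := by decide +kernel
/-- Soundness check. [cite: CookReckhow1979, §2 (sound rule)] -/
theorem check_B4_pos : rB4Pos.checkD 10 B4.ds = true := by decide +kernel
/-- Soundness check. [cite: CookReckhow1979, §2 (sound rule)] -/
theorem check_NG2_base : NG2.baseRule.check = true := by decide +kernel
/-- Soundness check. [cite: CookReckhow1979, §2 (sound rule)] -/
theorem check_NG2_step : NG2.stepRule.checkD 10 NG2.ds = true := by decide +kernel
/-- Soundness check. [cite: CookReckhow1979, §2 (sound rule)] -/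
theorem check_NG2_end : rNG2End.check = true := by decide +kernel
/-- Soundness check. [cite: CookReckhow1979, §2 (sound rule)] -/
theorem check_NG2L_base : NG2L.baseRule.check = true := by decide +kernel
/-- Soundness check. [cite: CookReckhow1979, §2 (sound rule)] -/
theorem check_NG2L_step : NG2L.stepRule.checkD 10 NG2L.ds = true := by decide +kernel
/-- Soundness check. [cite: CookReckhow1979, §2 (sound rule)] -/
theorem check_NG2L_end : rNG2LEnd.check = true := by decide +kernel
/-- Soundness check. [cite: CookReckhow1979, §2 (sound rule)] -/
theorem check_G1_base : G1.baseRule.check = true := by decide +kernel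
/-- Soundness check. [cite: CookReckhow1979, §2 (sound rule)] -/
theorem check_G1_step : G1.stepRule.checkD 7 G1.ds = true := by decide +kernel
/-- Soundness check. [cite: CookReckhow1979, §2 (sound rule)] -/
theorem check_G1_end : rG1End.check = true := by decide +kernel
/-- Soundness check. [cite: CookReckhow1979, §2 (sound rule)] -/
theorem check_G1L_base : G1L.baseRule.check = true := by decide +kernel
/-- Soundness check. [cite: CookReckhow1979, §2 (sound rule)] -/
theorem check_G1L_step : G1L.stepRule.checkD 7 G1L.ds = true := by decide +kernel
/-- Soundness check. [cite: CookReckhow1979, §2 (sound rule)] -/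
theorem check_G1L_end : rG1LEnd.check = true := by decide +kernel

/-- Every rule of the associativity layer is sound. [cite: CookReckhow1979, §2 (sound rule)] -/
theorem isSound_of_mem_assocRules : ∀ r ∈ assocRules, r.IsSound := by
  intro r hr
  simp only [assocRules, List.mem_cons, List.not_mem_nil, or_false] at hr
  rcases hr with rfl | rfl | rfl | rfl | rfl | rfl | rfl | rfl | rfl | rfl | rfl | rfl | rfl | rfl | rfl | rfl |
    rfl | rfl | rfl | rfl | rfl | rfl | rfl | rfl
  exacts [FregeRule.isSound_of_check check_SAC_base, FregeRule.isSound_of_checkD check_SAC_step,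
    FregeRule.isSound_of_checkD check_SAC_pos, FregeRule.isSound_of_check check_SACL_base,
    FregeRule.isSound_of_checkD check_SACL_step, FregeRule.isSound_of_checkD check_SACL_pos,
    FregeRule.isSound_of_check check_AU_base, FregeRule.isSound_of_checkD check_AU_step,
    FregeRule.isSound_of_checkD check_AU_pos, FregeRule.isSound_of_check check_B4_base,
    FregeRule.isSound_of_checkD check_B4_step, FregeRule.isSound_of_checkD check_B4_pos,
    FregeRule.isSound_of_check check_NG2_base, FregeRule.isSound_of_checkD check_NG2_step,
    FregeRule.isSound_of_check check_NG2_end, FregeRule.isSound_of_check check_NG2L_base,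
    FregeRule.isSound_of_checkD check_NG2L_step, FregeRule.isSound_of_check check_NG2L_end,
    FregeRule.isSound_of_check check_G1_base, FregeRule.isSound_of_checkD check_G1_step,
    FregeRule.isSound_of_check check_G1_end, FregeRule.isSound_of_check check_G1L_base,
    FregeRule.isSound_of_checkD check_G1L_step, FregeRule.isSound_of_check check_G1L_end]

/-- The leaf side conditions of the systems. [folklore] -/
theorem assocLeavesOK : SAC.LeavesOK ∧ SACL.LeavesOK ∧ AU.LeavesOK ∧ B4.LeavesOK ∧ NG2.LeavesOK ∧ NG2L.LeavesOK ∧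
    G1.LeavesOK ∧ G1L.LeavesOK :=
  ⟨System.leavesOK_of_leavesOKB (by decide +kernel), System.leavesOK_of_leavesOKB (by decide +kernel),
    System.leavesOK_of_leavesOKB (by decide +kernel), System.leavesOK_of_leavesOKB (by decide +kernel),
    System.leavesOK_of_leavesOKB (by decide +kernel), System.leavesOK_of_leavesOKB (by decide +kernel),
    System.leavesOK_of_leavesOKB (by decide +kernel), System.leavesOK_of_leavesOKB (by decide +kernel)⟩

/-- Membership in `assocRules` by position. [folklore] -/
theorem mem_assocRules {i : ℕ} (hi : i < assocRules.length) : assocRules[i] ∈ assocRules := List.getElem_mem hi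

/-! ### Local glue rules -/

/-- `c' ↔ maj(x, y, c)`, `¬x`, `¬y` give `¬c'`. [cite: CookReckhow1979, §2 (sound rule)] -/
def rMajFF : FregeRule :=
  ⟨[ctx (var 0) (biimp (var 1) (majF (var 2) (var 3) (var 4))), ctx (var 0) (neg (var 2)), ctx (var 0) (neg (var 3))],
    ctx (var 0) (neg (var 1))⟩
/-- `s ↔ xor3(x, y, c)`, `¬x`, `¬y`, `¬c` give `¬s`. [cite: CookReckhow1979, §2 (sound rule)] -/
def rXorFFF : FregeRule :=
  ⟨[ctx (var 0) (biimp (var 1) (xor3F (var 2) (var 3) (var 4))), ctx (var 0) (neg (var 2)), ctx (var 0) (neg (var 3)),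
    ctx (var 0) (neg (var 4))], ctx (var 0) (neg (var 1))⟩
/-- `a ↔ b`, `c ↔ b` give `a ↔ c`. [cite: CookReckhow1979, §2 (sound rule)] -/
def rTrans2 : FregeRule := ⟨[ctx (var 0) (eqv 1 2), ctx (var 0) (eqv 3 2)], ctx (var 0) (eqv 1 3)⟩
/-- Counting, case `¬g₁`: `¬g₁`, `g₂ ↔ e₁`, `¬e₂` give `g₁ + g₂ = e₁ + e₂`. [cite: CookReckhow1979, §2 (sound rule)] -/
def rCount0 : FregeRule :=
  ⟨[ctx (var 0) (neg (var 1)), ctx (var 0) (eqv 2 3), ctx (var 0) (neg (var 4))],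
    ctx (var 0) (Adder.invF (var 1) (var 2) (var 3) (var 4))⟩
/-- Counting, case `g₁`: `g₁`, `e₁`, `g₂ ↔ e₂` give `g₁ + g₂ = e₁ + e₂`. [cite: CookReckhow1979, §2 (sound rule)] -/
def rCount1 : FregeRule :=
  ⟨[ctx (var 0) (var 1), ctx (var 0) (var 3), ctx (var 0) (eqv 2 4)], ctx (var 0) (Adder.invF (var 1) (var 2) (var 3) (var 4))⟩
/-- `g₁ + g₂ = e₁ + e₂` and `g₃ + g₄ = e₁ + e₂` give `g₁ + g₂ = g₃ + g₄`. [cite: CookReckhow1979, §2 (sound rule)] -/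
def rValid : FregeRule :=
  ⟨[ctx (var 0) (Adder.invF (var 1) (var 2) (var 5) (var 6)), ctx (var 0) (Adder.invF (var 3) (var 4) (var 5) (var 6))],
    ctx (var 0) (Adder.invF (var 1) (var 2) (var 3) (var 4))⟩

/-- The glue rules of the associativity layer. [cite: CookReckhow1979, §2] -/
def glueRules : List FregeRule := [rMajFF, rXorFFF, rTrans2, rCount0, rCount1, rValid]

/-- Every glue rule is sound (truth tables). [cite: CookReckhow1979, §2 (sound rule)] -/
theorem isSound_of_mem_glueRules : ∀ r ∈ glueRules, r.IsSound := by
  intro r hr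
  simp only [glueRules, List.mem_cons, List.not_mem_nil, or_false] at hr
  rcases hr with rfl | rfl | rfl | rfl | rfl | rfl <;> exact FregeRule.isSound_of_check (by decide +kernel)

variable {G : FregeSystem} {K : PropForm ℕ} {Γ : Set (PropForm ℕ)}

/-- One inference by the `i`-th glue rule. [cite: CookReckhow1979, §2] -/
theorem glue (hG : ∀ r ∈ glueRules, r ∈ G.rules) (i : ℕ) (hi : i < glueRules.length) {S : Set (PropForm ℕ)}
    (σ : ℕ → PropForm ℕ) {θ : PropForm ℕ} (hθ : (glueRules[i]).conclusion.subst σ = θ)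
    (hp : ∀ p ∈ (glueRules[i]).premises, p.subst σ ∈ S) : G.IsInferredFrom S θ :=
  FregeSystem.IsInferredFrom.of_rule (hG _ (List.getElem_mem hi)) σ hθ hp

/-! ### Generic: invariant lines followed by per-position conclusions -/

/-- Substituting leaves for leaves preserves the size. [folklore] -/
theorem size_inst (f : ℕ → ℕ) (φ : PropForm ℕ) : (inst f φ).size = φ.size := by
  induction φ with
  | var k => rfl
  | const b => rfl
  | neg a ih => simp [inst, subst, size] at ih ⊢; exact ih
  | conj a b iha ihb => simp [inst, subst, size] at iha ihb ⊢; rw [iha, ihb]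
  | disj a b iha ihb => simp [inst, subst, size] at iha ihb ⊢; rw [iha, ihb]

/-- The invariant lines of `S`, then the conclusion `concl` at every position `i < W`. [folklore] -/
def posBlock (S : System) (K : PropForm ℕ) (act : ℕ → ℕ → ℕ) (W : ℕ) (concl : PropForm ℕ) : List (PropForm ℕ) :=
  S.lines K act W ++ (List.range W).map fun i => ctx K (inst (act i) concl)

/-- **A system with a per-position rule**: the induction, then the conclusion at every position
(the extra premises of the per-position rule available in `Γ`). [cite: CookReckhow1979, §2] -/
theorem isBlock_posBlock {S : System} (hok : S.LeavesOK) (hb : S.baseRule ∈ G.rules) (hs : S.stepRule ∈ G.rules)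
    {extra : List (PropForm ℕ)} {concl : PropForm ℕ} (hr : S.endRule extra concl ∈ G.rules)
    (hex : ∀ φ ∈ extra, ∀ k ∈ φ.vars, k ≠ 0) (hc : ∀ k ∈ concl.vars, k ≠ 0) (K : PropForm ℕ) (act : ℕ → ℕ → ℕ)
    (W : ℕ) (hcoh : ∀ i < W, ∀ k ∈ S.inv.vars, act (i + 1) k = act i (S.next k))
    (hci : ∀ φ ∈ S.cins, ctx K (inst (act 0) φ) ∈ Γ) (hsh : ∀ i < W, ∀ φ ∈ S.shapes, ctx K (inst (act i) φ) ∈ Γ)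
    (hextra : ∀ i < W, ∀ φ ∈ extra, ctx K (inst (act i) φ) ∈ Γ) : G.IsBlock Γ (posBlock S K act W concl) := by
  refine (System.isBlock_lines hok hb hs K act W hcoh hci hsh).append (Scaffold.isBlock_of_forall fun θ hθ => ?_)
  obtain ⟨i, hi, rfl⟩ := List.mem_map.1 hθ
  rw [List.mem_range] at hi
  exact Or.inr (System.isInferredFrom_end hok.inv_ne_zero hr hex hc K act i (Or.inr (System.mem_lines S K act hi.le))
    fun φ hφ => Or.inl (hextra i hi φ hφ))

/-- The conclusions of a `posBlock`. [folklore] -/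
theorem mem_posBlock {S : System} {K : PropForm ℕ} {act : ℕ → ℕ → ℕ} {W : ℕ} {concl : PropForm ℕ} {i : ℕ}
    (hi : i < W) : ctx K (inst (act i) concl) ∈ posBlock S K act W concl :=
  List.mem_append_right _ (List.mem_map.2 ⟨i, List.mem_range.2 hi, rfl⟩)

/-- The invariant lines are in a `posBlock`. [folklore] -/
theorem line_mem_posBlock {S : System} {K : PropForm ℕ} {act : ℕ → ℕ → ℕ} {W : ℕ} {concl : PropForm ℕ} {i : ℕ}
    (hi : i ≤ W) : S.line K act i ∈ posBlock S K act W concl :=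
  List.mem_append_left _ (System.mem_lines S K act hi)

/-- Size of a `posBlock`. [folklore] -/
theorem proofSize_posBlock (S : System) (K : PropForm ℕ) (act : ℕ → ℕ → ℕ) (W : ℕ) (concl : PropForm ℕ) :
    proofSize (posBlock S K act W concl) ≤ (W + 1) * (2 * K.size + S.inv.size + concl.size + 2) := by
  rw [posBlock, proofSize_append]
  have h₁ := System.proofSize_lines S K act W
  have h₂ : proofSize ((List.range W).map fun i => ctx K (inst (act i) concl)) ≤ W * (K.size + concl.size + 1) :=
    proofSize_map_range_le fun i _ => by simp [ctx, size, size_inst]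
  nlinarith [h₁, h₂]

/-! ### The data of associativity -/

/-- The data of the associativity law: the width, the operand words, the bases of the four
modular adders `M₁ = (a ⊕ b)`, `M₂ = (M₁ ⊕ c)`, `M₃ = (b ⊕ c)`, `M₄ = (a ⊕ M₃)`, of the two
comparators `a, c < n` (no hypothesis on `b` is needed), and of the scratch circuits. [folklore] -/
structure AssocData where
  /-- the width -/
  L : ℕ
  /-- first operand -/
  a : ℕ → ℕ
  /-- second operand -/
  b : ℕ → ℕ
  /-- third operand -/
  c : ℕ → ℕ
  /-- the modulus -/
  n : ℕ → ℕ
  /-- base of `M₁ = a ⊕ b` -/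
  b₁ : ℕ
  /-- base of `M₂ = s' ⊕ c` -/
  b₂ : ℕ
  /-- base of `M₃ = b ⊕ c` -/
  b₃ : ℕ
  /-- base of `M₄ = a ⊕ u'` -/
  b₄ : ℕ
  /-- base of the comparator `(a, n)` -/
  bA : ℕ
  /-- base of the comparator `(c, n)` -/
  bC : ℕ
  /-- base of the adder `Y = S₁ + c` -/
  bY : ℕ
  /-- base of the subtractor `E1 = Y - n` -/
  bE1 : ℕ
  /-- base of the multiplexers `y1s = g₁ ? E1.d : Y` -/
  by1s : ℕ
  /-- base of the subtractor `E2s = y1s - n` -/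
  bE2s : ℕ
  /-- base of the multiplexers `y1T = ge₁ ? E1.d : Y` -/
  by1T : ℕ
  /-- base of the subtractor `E2T = y1T - n` -/
  bE2T : ℕ
  /-- base of the multiplexers `wT = ge₂ ? E2T.d : y1T` -/
  bwT : ℕ
  /-- base of the multiplexers `y1V = ge₃ ? E1.d : Y` -/
  by1V : ℕ
  /-- base of the subtractor `E2V = y1V - n` -/
  bE2V : ℕ
  /-- base of the multiplexers `wV = ge₄ ? E2V.d : y1V` -/
  bwV : ℕ
  /-- base of the adder `AU = a + S₃` -/
  bAU : ℕ
  /-- base of the subtractor `EAU = AU - n` -/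
  bEAU : ℕ
  /-- base of the multiplexers `zV = ge₃ ? EAU.d : AU` -/
  bzV : ℕ

namespace AssocData

variable (d : AssocData)

/-- `M₁ = a ⊕ b`. [folklore] -/
def M₁ : View := ⟨d.b₁, d.a, d.b, d.n⟩
/-- `s' = R(M₁)`. [folklore] -/
def sp (i : ℕ) : ℕ := d.M₁.R d.L i
/-- `M₂ = s' ⊕ c`. [folklore] -/
def M₂ : View := ⟨d.b₂, d.sp, d.c, d.n⟩
/-- `t' = R(M₂) = (a ⊕ b) ⊕ c`. [folklore] -/
def tp (i : ℕ) : ℕ := d.M₂.R d.L i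
/-- `M₃ = b ⊕ c`. [folklore] -/
def M₃ : View := ⟨d.b₃, d.b, d.c, d.n⟩
/-- `u' = R(M₃)`. [folklore] -/
def up (i : ℕ) : ℕ := d.M₃.R d.L i
/-- `M₄ = a ⊕ u'`. [folklore] -/
def M₄ : View := ⟨d.b₄, d.a, d.up, d.n⟩
/-- `v' = R(M₄) = a ⊕ (b ⊕ c)`. [folklore] -/
def vp (i : ℕ) : ℕ := d.M₄.R d.L i
/-- The comparator `(a, n)`. [folklore] -/
def A : Sub.View := ⟨d.bA, d.a, d.n⟩
/-- The comparator `(c, n)`. [folklore] -/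
def C : Sub.View := ⟨d.bC, d.c, d.n⟩
/-- `Y = S₁ + c` (sum bits of `S₁`). [folklore] -/
def Y : Adder.View := ⟨d.bY, d.M₁.S.s, d.c⟩
/-- `E1 = Y - n`. [folklore] -/
def E1 : Sub.View := ⟨d.bE1, d.Y.s, d.n⟩
/-- `g₁ = [Y ≥ n]`. [folklore] -/
def g₁ : ℕ := d.E1.ge d.L d.L
/-- `y1s = g₁ ? E1.d : Y`. [folklore] -/
def y1s (i : ℕ) : ℕ := d.by1s + i
/-- `E2s = y1s - n`. [folklore] -/
def E2s : Sub.View := ⟨d.bE2s, d.y1s, d.n⟩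
/-- `g₂ = [y1s ≥ n]`. [folklore] -/
def g₂ : ℕ := d.E2s.ge d.L d.L
/-- `y1T = ge₁ ? E1.d : Y`. [folklore] -/
def y1T (i : ℕ) : ℕ := d.by1T + i
/-- `E2T = y1T - n`. [folklore] -/
def E2T : Sub.View := ⟨d.bE2T, d.y1T, d.n⟩
/-- `wT = ge₂ ? E2T.d : y1T`. [folklore] -/
def wT (i : ℕ) : ℕ := d.bwT + i
/-- `y1V = ge₃ ? E1.d : Y`. [folklore] -/
def y1V (i : ℕ) : ℕ := d.by1V + i
/-- `E2V = y1V - n`. [folklore] -/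
def E2V : Sub.View := ⟨d.bE2V, d.y1V, d.n⟩
/-- `wV = ge₄ ? E2V.d : y1V`. [folklore] -/
def wV (i : ℕ) : ℕ := d.bwV + i
/-- `AU = a + S₃`. [folklore] -/
def AU : Adder.View := ⟨d.bAU, d.a, d.M₃.S.s⟩
/-- `EAU = AU - n`. [folklore] -/
def EAU : Sub.View := ⟨d.bEAU, d.AU.s, d.n⟩
/-- `zV = ge₃ ? EAU.d : AU`. [folklore] -/
def zV (i : ℕ) : ℕ := d.bzV + i

/-- A multiplexer definition line `g ↔ sel ? x : y`. [folklore] -/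
def muxLine (g sel x y : ℕ) : PropForm ℕ := biimp (var g) (muxF (var sel) (var x) (var y))

/-- All definition lines used by the associativity law are available. [folklore] -/
structure Avail (K : PropForm ℕ) (Γ : Set (PropForm ℕ)) : Prop where
  /-- `M₁` -/
  hM₁ : d.M₁.Avail K Γ d.L
  /-- `M₂` -/
  hM₂ : d.M₂.Avail K Γ d.L
  /-- `M₃` -/
  hM₃ : d.M₃.Avail K Γ d.L
  /-- `M₄` -/
  hM₄ : d.M₄.Avail K Γ d.L
  /-- `A` -/
  hA : d.A.Avail K Γ d.L
  /-- `C` -/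
  hC : d.C.Avail K Γ d.L
  /-- `Y` -/
  hY : d.Y.Avail K Γ false d.L
  /-- `E1` -/
  hE1 : d.E1.Avail K Γ d.L
  /-- `y1s` -/
  hy1s : ∀ i < d.L, ctx K (muxLine (d.y1s i) d.g₁ (d.E1.d d.L i) (d.Y.s i)) ∈ Γ
  /-- `E2s` -/
  hE2s : d.E2s.Avail K Γ d.L
  /-- `y1T` -/
  hy1T : ∀ i < d.L, ctx K (muxLine (d.y1T i) (d.M₁.ge d.L) (d.E1.d d.L i) (d.Y.s i)) ∈ Γ
  /-- `E2T` -/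
  hE2T : d.E2T.Avail K Γ d.L
  /-- `wT` -/
  hwT : ∀ i < d.L, ctx K (muxLine (d.wT i) (d.M₂.ge d.L) (d.E2T.d d.L i) (d.y1T i)) ∈ Γ
  /-- `y1V` -/
  hy1V : ∀ i < d.L, ctx K (muxLine (d.y1V i) (d.M₃.ge d.L) (d.E1.d d.L i) (d.Y.s i)) ∈ Γ
  /-- `E2V` -/
  hE2V : d.E2V.Avail K Γ d.L
  /-- `wV` -/
  hwV : ∀ i < d.L, ctx K (muxLine (d.wV i) (d.M₄.ge d.L) (d.E2V.d d.L i) (d.y1V i)) ∈ Γ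
  /-- `AU` -/
  hAU : d.AU.Avail K Γ false d.L
  /-- `EAU` -/
  hEAU : d.EAU.Avail K Γ d.L
  /-- `zV` -/
  hzV : ∀ i < d.L, ctx K (muxLine (d.zV i) (d.M₃.ge d.L) (d.EAU.d d.L i) (d.AU.s i)) ∈ Γ

/-- Availability is monotone. [folklore] -/
theorem Avail.mono {d : AssocData} {K : PropForm ℕ} {Γ Γ' : Set (PropForm ℕ)} (h : d.Avail K Γ) (hΓ : Γ ⊆ Γ') :
    d.Avail K Γ' :=
  ⟨h.hM₁.mono hΓ, h.hM₂.mono hΓ, h.hM₃.mono hΓ, h.hM₄.mono hΓ, h.hA.mono hΓ, h.hC.mono hΓ, h.hY.mono hΓ,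
    h.hE1.mono hΓ, fun i hi => hΓ (h.hy1s i hi), h.hE2s.mono hΓ, fun i hi => hΓ (h.hy1T i hi), h.hE2T.mono hΓ,
    fun i hi => hΓ (h.hwT i hi), fun i hi => hΓ (h.hy1V i hi), h.hE2V.mono hΓ, fun i hi => hΓ (h.hwV i hi),
    h.hAU.mono hΓ, h.hEAU.mono hΓ, fun i hi => hΓ (h.hzV i hi)⟩

/-! ### Sub-block 1: `S₂ ≡ y1T` (system `SAC`) -/

/-- Leaf assignment of `SAC`. [folklore] -/
def actSAC (i : ℕ) (k : ℕ) : ℕ :=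
  [0, d.M₁.Dc d.L i, d.M₂.S.c i, d.Y.c i, d.E1.ge d.L i, d.M₁.ge d.L, d.M₁.S.s i, d.c i, d.n i,
    (d.M₁.D d.L).ny i, d.M₁.d d.L i, d.M₁.Dc d.L (i + 1), d.sp i, d.M₂.S.s i, d.M₂.S.c (i + 1), d.Y.s i,
    d.Y.c (i + 1), d.E1.ny i, d.E1.d d.L i, d.E1.ge d.L (i + 1), d.y1T i].getD k 0

/-- The lines of sub-block 1. [folklore] -/
def sb1 (K : PropForm ℕ) : List (PropForm ℕ) := posBlock SAC K d.actSAC d.L (biimp (var 13) (var 20))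

/-- Availability of the shapes of `SAC`. [folklore] -/
theorem availSAC (h : d.Avail K Γ) : ∀ i < d.L, ∀ φ ∈ SAC.shapes, ctx K (inst (d.actSAC i) φ) ∈ Γ := by
  intro i hi φ hφ
  simp only [SAC, List.mem_cons, List.not_mem_nil, or_false] at hφ
  rcases hφ with rfl | rfl | rfl | rfl | rfl | rfl | rfl | rfl | rfl | rfl | rfl | rfl
  exacts [h.hM₁.2.1.1 i hi, (h.hM₁.2.1.2.2 i hi).1, (h.hM₁.2.1.2.2 i hi).2, h.hM₁.2.2 i hi, (h.hM₂.1.2 i hi).1,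
    (h.hM₂.1.2 i hi).2, (h.hY.2 i hi).1, (h.hY.2 i hi).2, h.hE1.1 i hi, (h.hE1.2.2 i hi).1, (h.hE1.2.2 i hi).2,
    h.hy1T i hi]

/-- **Sub-block 1**: `S₂ = s' + c ≡ y1T = (S₁ + c) ⊖_{ge₁} n`, bitwise. [cite: CookReckhow1979, §2] -/
theorem isBlock_sb1 (hG : ∀ r ∈ assocRules, r ∈ G.rules) (h : d.Avail K Γ) : G.IsBlock Γ (d.sb1 K) :=
  isBlock_posBlock assocLeavesOK.1 (hG _ (mem_assocRules (i := 0) (by decide))) (hG _ (mem_assocRules (i := 1) (by decide)))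
    (hG _ (mem_assocRules (i := 2) (by decide))) assocLeavesOK.1.2.1 (ne_zero_of_allVarsB (by decide +kernel)) K d.actSAC d.L
    (hcoh_of (p := fun k => decide (1 ≤ k ∧ k ≤ 5)) (by decide +kernel) fun i _ k hk => by
      simp only [decide_eq_true_eq] at hk
      obtain ⟨hk₁, hk₂⟩ := hk
      interval_cases k <;> rfl)
    (fun φ hφ => by
      simp only [SAC, List.mem_cons, List.not_mem_nil, or_false] at hφ
      rcases hφ with rfl | rfl | rfl | rfl
      exacts [h.hM₁.2.1.2.1, h.hM₂.1.1, h.hY.1, h.hE1.2.1])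
    (d.availSAC h) (d.availSAC h)

/-- Conclusions of sub-block 1. [folklore] -/
theorem mem_sb1 {i : ℕ} (hi : i < d.L) : ctx K (eqv (d.M₂.S.s i) (d.y1T i)) ∈ d.sb1 K := mem_posBlock hi

/-! ### Sub-block 2: `S₄ ≡ zV` (system `SACL`) -/

/-- Leaf assignment of `SACL`. [folklore] -/
def actSACL (i : ℕ) (k : ℕ) : ℕ :=
  [0, d.M₃.Dc d.L i, d.M₄.S.c i, d.AU.c i, d.EAU.ge d.L i, d.M₃.ge d.L, d.M₃.S.s i, d.a i, d.n i,
    (d.M₃.D d.L).ny i, d.M₃.d d.L i, d.M₃.Dc d.L (i + 1), d.up i, d.M₄.S.s i, d.M₄.S.c (i + 1), d.AU.s i,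
    d.AU.c (i + 1), d.EAU.ny i, d.EAU.d d.L i, d.EAU.ge d.L (i + 1), d.zV i].getD k 0

/-- The lines of sub-block 2. [folklore] -/
def sb2 (K : PropForm ℕ) : List (PropForm ℕ) := posBlock SACL K d.actSACL d.L (biimp (var 13) (var 20))

/-- Availability of the shapes of `SACL`. [folklore] -/
theorem availSACL (h : d.Avail K Γ) : ∀ i < d.L, ∀ φ ∈ SACL.shapes, ctx K (inst (d.actSACL i) φ) ∈ Γ := by
  intro i hi φ hφ
  simp only [SACL, List.mem_cons, List.not_mem_nil, or_false] at hφ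
  rcases hφ with rfl | rfl | rfl | rfl | rfl | rfl | rfl | rfl | rfl | rfl | rfl | rfl
  exacts [h.hM₃.2.1.1 i hi, (h.hM₃.2.1.2.2 i hi).1, (h.hM₃.2.1.2.2 i hi).2, h.hM₃.2.2 i hi, (h.hM₄.1.2 i hi).1,
    (h.hM₄.1.2 i hi).2, (h.hAU.2 i hi).1, (h.hAU.2 i hi).2, h.hEAU.1 i hi, (h.hEAU.2.2 i hi).1, (h.hEAU.2.2 i hi).2,
    h.hzV i hi]

/-- **Sub-block 2**: `S₄ = a + u' ≡ zV = (a + S₃) ⊖_{ge₃} n`, bitwise. [cite: CookReckhow1979, §2] -/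
theorem isBlock_sb2 (hG : ∀ r ∈ assocRules, r ∈ G.rules) (h : d.Avail K Γ) : G.IsBlock Γ (d.sb2 K) :=
  isBlock_posBlock assocLeavesOK.2.1 (hG _ (mem_assocRules (i := 3) (by decide))) (hG _ (mem_assocRules (i := 4) (by decide)))
    (hG _ (mem_assocRules (i := 5) (by decide))) assocLeavesOK.2.1.2.1 (ne_zero_of_allVarsB (by decide +kernel)) K d.actSACL
    d.L
    (hcoh_of (p := fun k => decide (1 ≤ k ∧ k ≤ 5)) (by decide +kernel) fun i _ k hk => by
      simp only [decide_eq_true_eq] at hk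
      obtain ⟨hk₁, hk₂⟩ := hk
      interval_cases k <;> rfl)
    (fun φ hφ => by
      simp only [SACL, List.mem_cons, List.not_mem_nil, or_false] at hφ
      rcases hφ with rfl | rfl | rfl | rfl
      exacts [h.hM₃.2.1.2.1, h.hM₄.1.1, h.hAU.1, h.hEAU.2.1])
    (d.availSACL h) (d.availSACL h)

/-- Conclusions of sub-block 2. [folklore] -/
theorem mem_sb2 {i : ℕ} (hi : i < d.L) : ctx K (eqv (d.M₄.S.s i) (d.zV i)) ∈ d.sb2 K := mem_posBlock hi

/-! ### Sub-block 3: `Y ≡ AU` (system `AU`) -/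

/-- Leaf assignment of `AU`. [folklore] -/
def actAU (i : ℕ) (k : ℕ) : ℕ :=
  [0, d.M₁.S.c i, d.Y.c i, d.M₃.S.c i, d.AU.c i, d.a i, d.b i, d.c i, d.M₁.S.s i, d.M₁.S.c (i + 1), d.Y.s i,
    d.Y.c (i + 1), d.M₃.S.s i, d.M₃.S.c (i + 1), d.AU.s i, d.AU.c (i + 1)].getD k 0

/-- The lines of sub-block 3. [folklore] -/
def sb3 (K : PropForm ℕ) : List (PropForm ℕ) := posBlock ModAddU.AU K d.actAU d.L (biimp (var 10) (var 14))

/-- Availability of the shapes of `AU`. [folklore] -/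
theorem availAU (h : d.Avail K Γ) : ∀ i < d.L, ∀ φ ∈ ModAddU.AU.shapes, ctx K (inst (d.actAU i) φ) ∈ Γ := by
  intro i hi φ hφ
  simp only [ModAddU.AU, List.mem_cons, List.not_mem_nil, or_false] at hφ
  rcases hφ with rfl | rfl | rfl | rfl | rfl | rfl | rfl | rfl
  exacts [(h.hM₁.1.2 i hi).1, (h.hM₁.1.2 i hi).2, (h.hY.2 i hi).1, (h.hY.2 i hi).2, (h.hM₃.1.2 i hi).1,
    (h.hM₃.1.2 i hi).2, (h.hAU.2 i hi).1, (h.hAU.2 i hi).2]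

/-- **Sub-block 3**: `Y = (a + b) + c ≡ AU = a + (b + c)`, bitwise (one width). [cite: CookReckhow1979, §2] -/
theorem isBlock_sb3 (hG : ∀ r ∈ assocRules, r ∈ G.rules) (h : d.Avail K Γ) : G.IsBlock Γ (d.sb3 K) :=
  isBlock_posBlock assocLeavesOK.2.2.1 (hG _ (mem_assocRules (i := 6) (by decide)))
    (hG _ (mem_assocRules (i := 7) (by decide))) (hG _ (mem_assocRules (i := 8) (by decide))) assocLeavesOK.2.2.1.2.1
    (ne_zero_of_allVarsB (by decide +kernel)) K d.actAU d.L
    (hcoh_of (p := fun k => decide (1 ≤ k ∧ k ≤ 4)) (by decide +kernel) fun i _ k hk => by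
      simp only [decide_eq_true_eq] at hk
      obtain ⟨hk₁, hk₂⟩ := hk
      interval_cases k <;> rfl)
    (fun φ hφ => by
      simp only [ModAddU.AU, List.mem_cons, List.not_mem_nil, or_false] at hφ
      rcases hφ with rfl | rfl | rfl | rfl
      exacts [h.hM₁.1.1, h.hY.1, h.hM₃.1.1, h.hAU.1])
    (d.availAU h) (d.availAU h)

/-- Conclusions of sub-block 3. [folklore] -/
theorem mem_sb3 {i : ℕ} (hi : i < d.L) : ctx K (eqv (d.Y.s i) (d.AU.s i)) ∈ d.sb3 K := mem_posBlock hi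

/-! ### Glue: reflexivity, multiplexer congruence -/

/-- The reflexivity line `x ↔ x`. [folklore] -/
theorem isBlock_refl (hGA : ∀ r ∈ Adder.rules, r ∈ G.rules) (K : PropForm ℕ) (x : ℕ) {T : Set (PropForm ℕ)} :
    G.IsBlock T [ctx K (eqv x x)] :=
  FregeSystem.IsBlock.singleton (Or.inr (FregeSystem.IsInferredFrom.of_rule (hGA _ Adder.mem_rules.1)
    (FregeSystem.sub [K, var x]) rfl FregeSystem.prems_nil))

/-- Multiplexer congruence lines `g i ↔ g' i` for `i < W`. [folklore] -/
def muxLeibLines (K : PropForm ℕ) (g g' : ℕ → ℕ) (W : ℕ) : List (PropForm ℕ) :=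
  (List.range W).map fun i => ctx K (eqv (g i) (g' i))

/-- **Multiplexer congruence**: from the two definitions and the equalities of selector and data.
[cite: CookReckhow1979, §2] -/
theorem isBlock_muxLeibLines (hGN : ∀ r ∈ Netlist.rules, r ∈ G.rules) (K : PropForm ℕ) {g g' x x' y y' : ℕ → ℕ}
    {sel sel' : ℕ} {W : ℕ} {T : Set (PropForm ℕ)} (hg : ∀ i < W, ctx K (muxLine (g i) sel (x i) (y i)) ∈ T)
    (hg' : ∀ i < W, ctx K (muxLine (g' i) sel' (x' i) (y' i)) ∈ T) (hsel : ctx K (eqv sel sel') ∈ T)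
    (hx : ∀ i < W, ctx K (eqv (x i) (x' i)) ∈ T) (hy : ∀ i < W, ctx K (eqv (y i) (y' i)) ∈ T) :
    G.IsBlock T (muxLeibLines K g g' W) :=
  Scaffold.isBlock_of_forall fun θ hθ => by
    obtain ⟨i, hi, rfl⟩ := List.mem_map.1 hθ
    rw [List.mem_range] at hi
    exact Or.inr (FregeSystem.IsInferredFrom.of_rule (hGN _ (rLeib_mem_rules Kind.mux))
      (FregeSystem.sub [K, var (g i), var sel, var (x i), var (y i), var (g' i), var sel', var (x' i), var (y' i)]) rfl
      (FregeSystem.prems_cons (hg i hi) (FregeSystem.prems_cons (hg' i hi) (FregeSystem.prems_cons hsel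
        (FregeSystem.prems_cons (hx i hi) (FregeSystem.prems_cons (hy i hi) FregeSystem.prems_nil))))))

/-- The lines of `muxLeibLines`. [folklore] -/
theorem mem_muxLeibLines {K : PropForm ℕ} {g g' : ℕ → ℕ} {W i : ℕ} (hi : i < W) :
    ctx K (eqv (g i) (g' i)) ∈ muxLeibLines K g g' W :=
  List.mem_map.2 ⟨i, List.mem_range.2 hi, rfl⟩

/-- Size of `muxLeibLines`. [folklore] -/
theorem proofSize_muxLeibLines (K : PropForm ℕ) (g g' : ℕ → ℕ) (W : ℕ) :
    proofSize (muxLeibLines K g g' W) ≤ W * (K.size + 10) :=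
  proofSize_map_range_le fun i _ => by simp [ctx, eqv, size, FregeSystem.size_biimp]

/-! ### Chain T: `t' ≡ wT` -/

/-- The lines of chain T: `D₂ ≡ E2T` wire by wire, then `t' ≡ wT`. [folklore] -/
def chainT (K : PropForm ℕ) : List (PropForm ℕ) :=
  Sub.leibLines (d.M₂.D d.L) d.E2T K d.L ++ muxLeibLines K d.tp d.wT d.L

/-- **Chain T**: with `S₂ ≡ y1T` (sub-block 1) and the reflexivity lines of `n` and `ge₂`
available, `D₂ ≡ E2T` and `t' ≡ wT` bitwise. [cite: CookReckhow1979, §2] -/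
theorem isBlock_chainT (hGN : ∀ r ∈ Netlist.rules, r ∈ G.rules) (hGL : ∀ r ∈ Logic.rules, r ∈ G.rules)
    {T : Set (PropForm ℕ)} (h : d.Avail K T) (h₁ : ∀ i < d.L, ctx K (eqv (d.M₂.S.s i) (d.y1T i)) ∈ T)
    (hn : ∀ i < d.L, ctx K (eqv (d.n i) (d.n i)) ∈ T) (hge : ctx K (eqv (d.M₂.ge d.L) (d.M₂.ge d.L)) ∈ T) :
    G.IsBlock T (d.chainT K) :=
  (Sub.isBlock_leibLines hGN hGL _ _ h.hM₂.2.1 h.hE2T h₁ hn).append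
    (isBlock_muxLeibLines hGN K (fun i hi => Or.inl (h.hM₂.2.2 i hi)) (fun i hi => Or.inl (h.hwT i hi)) (Or.inl hge)
      (fun i hi => Or.inr (Sub.mem_leibLines (by omega))) fun i hi => Or.inl (h₁ i hi))

/-- Conclusions of chain T: `t'ᵢ ↔ wTᵢ`. [folklore] -/
theorem tp_mem_chainT {i : ℕ} (hi : i < d.L) : ctx K (eqv (d.tp i) (d.wT i)) ∈ d.chainT K :=
  List.mem_append_right _ (mem_muxLeibLines hi)

/-- Conclusions of chain T: `ge₂ ↔ ge(E2T)`. [folklore] -/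
theorem ge_mem_chainT : ctx K (eqv (d.M₂.ge d.L) (d.E2T.ge d.L d.L)) ∈ d.chainT K :=
  List.mem_append_left _ (Sub.mem_leibLines (by omega))

/-- Size of chain T. [folklore] -/
theorem proofSize_chainT : proofSize (d.chainT K) ≤ (4 * d.L + 1) * (K.size + 10) := by
  rw [chainT, proofSize_append]
  nlinarith [Sub.proofSize_leibLines (d.M₂.D d.L) d.E2T K d.L, proofSize_muxLeibLines K d.tp d.wT d.L]

/-! ### Chain V: `S₄ ≡ y1V`, `v' ≡ wV` -/

/-- The lines of chain V: `E1 ≡ EAU`; `y1V ≡ zV`; `S₄ ≡ y1V`; `D₄ ≡ E2V`; `v' ≡ wV`. [folklore] -/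
def chainV (K : PropForm ℕ) : List (PropForm ℕ) :=
  Sub.leibLines d.E1 d.EAU K d.L ++ (muxLeibLines K d.y1V d.zV d.L ++
    ((List.range d.L).map (fun i => ctx K (eqv (d.M₄.S.s i) (d.y1V i))) ++
      (Sub.leibLines (d.M₄.D d.L) d.E2V K d.L ++ muxLeibLines K d.vp d.wV d.L)))

/-- **Chain V**: with `S₄ ≡ zV` (sub-block 2), `Y ≡ AU` (sub-block 3) and reflexivity lines
available, `S₄ ≡ y1V`, `D₄ ≡ E2V` and `v' ≡ wV` bitwise. [cite: CookReckhow1979, §2] -/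
theorem isBlock_chainV (hGN : ∀ r ∈ Netlist.rules, r ∈ G.rules) (hGL : ∀ r ∈ Logic.rules, r ∈ G.rules)
    (hGG : ∀ r ∈ glueRules, r ∈ G.rules) {T : Set (PropForm ℕ)} (h : d.Avail K T)
    (h₂ : ∀ i < d.L, ctx K (eqv (d.M₄.S.s i) (d.zV i)) ∈ T) (h₃ : ∀ i < d.L, ctx K (eqv (d.Y.s i) (d.AU.s i)) ∈ T)
    (hn : ∀ i < d.L, ctx K (eqv (d.n i) (d.n i)) ∈ T) (hge₃ : ctx K (eqv (d.M₃.ge d.L) (d.M₃.ge d.L)) ∈ T)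
    (hge₄ : ctx K (eqv (d.M₄.ge d.L) (d.M₄.ge d.L)) ∈ T) : G.IsBlock T (d.chainV K) := by
  refine (Sub.isBlock_leibLines hGN hGL _ _ h.hE1 h.hEAU h₃ hn).append
    ((isBlock_muxLeibLines hGN K (fun i hi => Or.inl (h.hy1V i hi)) (fun i hi => Or.inl (h.hzV i hi)) (Or.inl hge₃)
      (fun i hi => Or.inr (Sub.mem_leibLines (by omega))) (fun i hi => Or.inl (h₃ i hi))).append
      ((Scaffold.isBlock_of_forall fun θ hθ => ?_).append
        ((Sub.isBlock_leibLines hGN hGL _ _ (h.hM₄.2.1.mono ?_) (h.hE2V.mono ?_) (fun i hi => Or.inr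
          (show ctx K (eqv (d.M₄.S.s i) (d.y1V i)) ∈ (List.range d.L).map (fun i => ctx K (eqv (d.M₄.S.s i) (d.y1V i)))
            from List.mem_map.2 ⟨i, List.mem_range.2 hi, rfl⟩)) (fun i hi => Or.inl (Or.inl (Or.inl (hn i hi))))).append
          (isBlock_muxLeibLines hGN K (fun i hi => Or.inl (Or.inl (Or.inl (Or.inl (h.hM₄.2.2 i hi)))))
            (fun i hi => Or.inl (Or.inl (Or.inl (Or.inl (h.hwV i hi))))) (Or.inl (Or.inl (Or.inl (Or.inl hge₄))))
            (fun i hi => Or.inr (Sub.mem_leibLines (by omega)))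
            fun i hi => Or.inl (Or.inr (List.mem_map.2 ⟨i, List.mem_range.2 hi, rfl⟩))))))
  · obtain ⟨i, hi, rfl⟩ := List.mem_map.1 hθ
    rw [List.mem_range] at hi
    exact Or.inr (glue hGG 2 (by decide) (FregeSystem.sub [K, var (d.M₄.S.s i), var (d.zV i), var (d.y1V i)]) rfl
      (FregeSystem.prems_cons (Or.inl (Or.inl (h₂ i hi))) (FregeSystem.prems_cons (Or.inr (mem_muxLeibLines hi))
        FregeSystem.prems_nil)))
  · exact fun χ hχ => Or.inl (Or.inl (Or.inl hχ))
  · exact fun χ hχ => Or.inl (Or.inl (Or.inl hχ))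

/-- Conclusions of chain V: `v'ᵢ ↔ wVᵢ`. [folklore] -/
theorem vp_mem_chainV {i : ℕ} (hi : i < d.L) : ctx K (eqv (d.vp i) (d.wV i)) ∈ d.chainV K := by
  simp only [chainV, List.mem_append]
  exact Or.inr (Or.inr (Or.inr (Or.inr (mem_muxLeibLines hi))))

/-- Conclusions of chain V: `ge₄ ↔ ge(E2V)`. [folklore] -/
theorem ge_mem_chainV : ctx K (eqv (d.M₄.ge d.L) (d.E2V.ge d.L d.L)) ∈ d.chainV K := by
  simp only [chainV, List.mem_append]
  exact Or.inr (Or.inr (Or.inr (Or.inl (Sub.mem_leibLines (by omega)))))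

/-- Conclusions of chain V: `E1 ≡ EAU` (difference bits). [folklore] -/
theorem e1_mem_chainV {k : ℕ} (hk : k < 2 * d.L + 1) :
    ctx K (eqv ((d.E1.adder d.L).wire k) ((d.EAU.adder d.L).wire k)) ∈ d.chainV K := by
  simp only [chainV, List.mem_append]
  exact Or.inl (Sub.mem_leibLines hk)

/-- Conclusions of chain V: `y1Vᵢ ↔ zVᵢ`. [folklore] -/
theorem y1V_mem_chainV {i : ℕ} (hi : i < d.L) : ctx K (eqv (d.y1V i) (d.zV i)) ∈ d.chainV K := by
  simp only [chainV, List.mem_append]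
  exact Or.inr (Or.inl (mem_muxLeibLines hi))

/-- Size of chain V. [folklore] -/
theorem proofSize_chainV : proofSize (d.chainV K) ≤ (9 * d.L + 2) * (K.size + 10) := by
  simp only [chainV, proofSize_append]
  have h₃ : proofSize ((List.range d.L).map fun i => ctx K (eqv (d.M₄.S.s i) (d.y1V i))) ≤ d.L * (K.size + 10) :=
    proofSize_map_range_le fun i _ => by simp [ctx, eqv, size, FregeSystem.size_biimp]
  nlinarith [Sub.proofSize_leibLines d.E1 d.EAU K d.L, proofSize_muxLeibLines K d.y1V d.zV d.L,
    Sub.proofSize_leibLines (d.M₄.D d.L) d.E2V K d.L, proofSize_muxLeibLines K d.vp d.wV d.L, h₃]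

/-! ### Definition lists (for weakening into case contexts) -/

/-- The definition lines of a subtractor view, as a list. [folklore] -/
def subDefList (V : Sub.View) (w : ℕ) : List (PropForm ℕ) :=
  (List.range w).map V.notDef ++ ([(V.adder w).cinDef true] ++
    ((List.range w).map (V.adder w).sumDef ++ (List.range w).map (V.adder w).carryDef))

/-- Availability from the definition list. [folklore] -/
theorem subAvail_of_forall {V : Sub.View} {w : ℕ} {K : PropForm ℕ} {T : Set (PropForm ℕ)}
    (h : ∀ θ ∈ subDefList V w, ctx K θ ∈ T) : V.Avail K T w :=
  ⟨fun j hj => h _ (List.mem_append_left _ (List.mem_map.2 ⟨j, List.mem_range.2 hj, rfl⟩)),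
    h _ (List.mem_append_right _ (List.mem_append_left _ (List.mem_singleton_self _))), fun i hi =>
    ⟨h _ (List.mem_append_right _ (List.mem_append_right _ (List.mem_append_left _
      (List.mem_map.2 ⟨i, List.mem_range.2 hi, rfl⟩)))),
     h _ (List.mem_append_right _ (List.mem_append_right _ (List.mem_append_right _
      (List.mem_map.2 ⟨i, List.mem_range.2 hi, rfl⟩))))⟩⟩

/-- The definition list from availability. [folklore] -/
theorem forall_of_subAvail {V : Sub.View} {w : ℕ} {K : PropForm ℕ} {T : Set (PropForm ℕ)} (h : V.Avail K T w) :
    ∀ θ ∈ subDefList V w, ctx K θ ∈ T := by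
  intro θ hθ
  simp only [subDefList, List.mem_append, List.mem_map, List.mem_range, List.mem_singleton] at hθ
  rcases hθ with ⟨j, hj, rfl⟩ | rfl | ⟨i, hi, rfl⟩ | ⟨i, hi, rfl⟩
  exacts [h.1 j hj, h.2.1, (h.2.2 i hi).1, (h.2.2 i hi).2]

/-- Sizes of the definition lines. [folklore] -/
theorem size_defs (V : Adder.View) (S : Sub.View) (i : ℕ) (c₀ : Bool) :
    (V.sumDef i).size = 57 ∧ (V.carryDef i).size = 25 ∧ (V.cinDef c₀).size = 9 ∧ (S.notDef i).size = 11 := by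
  refine ⟨?_, ?_, ?_, ?_⟩
  · rw [Adder.View.sumDef, FregeSystem.size_biimp, xor3F, FregeSystem.size_biimp, FregeSystem.size_biimp]; simp [size]
  · rw [Adder.View.carryDef, FregeSystem.size_biimp]; simp [size, majF]
  · rw [Adder.View.cinDef, FregeSystem.size_biimp]; simp [size]
  · rw [Sub.View.notDef, FregeSystem.size_biimp]; simp [size]

/-- Sum of a constant over `List.range`. [folklore] -/
theorem sum_map_range_const {α : Type} (l : List α) (c : ℕ) {f : α → ℕ} (h : ∀ x ∈ l, f x = c) :
    (l.map f).sum = l.length * c := by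
  rw [List.map_congr_left h, List.map_const', List.sum_replicate, smul_eq_mul]

/-- Size of the definition list of a subtractor. [folklore] -/
theorem sum_size_subDefList (V : Sub.View) (w : ℕ) : ((subDefList V w).map size).sum = 93 * w + 9 := by
  simp only [subDefList, List.map_append, List.map_map, List.sum_append, List.map_cons, List.map_nil, List.sum_cons,
    List.sum_nil]
  rw [sum_map_range_const (f := size ∘ V.notDef) _ 11 fun j _ => (size_defs (V.adder w) V j true).2.2.2,
    sum_map_range_const (f := size ∘ (V.adder w).sumDef) _ 57 fun j _ => (size_defs (V.adder w) V j true).1,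
    sum_map_range_const (f := size ∘ (V.adder w).carryDef) _ 25 fun j _ => (size_defs (V.adder w) V j true).2.1,
    (size_defs (V.adder w) V 0 true).2.2.1, List.length_range]
  ring

/-- The multiplexer definition lines `g i ↔ sel ? x i : y i`, `i < W`, as a list. [folklore] -/
def muxDefList (g : ℕ → ℕ) (sel : ℕ) (x y : ℕ → ℕ) (W : ℕ) : List (PropForm ℕ) :=
  (List.range W).map fun i => muxLine (g i) sel (x i) (y i)

/-- Membership in `muxDefList`. [folklore] -/
theorem mem_muxDefList {g : ℕ → ℕ} {sel : ℕ} {x y : ℕ → ℕ} {W i : ℕ} (hi : i < W) :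
    muxLine (g i) sel (x i) (y i) ∈ muxDefList g sel x y W :=
  List.mem_map.2 ⟨i, List.mem_range.2 hi, rfl⟩

/-- Size of `muxDefList`. [folklore] -/
theorem sum_size_muxDefList (g : ℕ → ℕ) (sel : ℕ) (x y : ℕ → ℕ) (W : ℕ) :
    ((muxDefList g sel x y W).map size).sum = 23 * W := by
  rw [muxDefList, List.map_map, sum_map_range_const (f := size ∘ fun i => muxLine (g i) sel (x i) (y i)) _ 23
    fun i _ => ?_, List.length_range, Nat.mul_comm]
  show (muxLine (g i) sel (x i) (y i)).size = 23
  rw [muxLine, FregeSystem.size_biimp]; simp [size, muxF]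

/-! ### Sub-blocks 5–8: the invariant lines of `NG2`, `G1`, `NG2L`, `G1L` -/

/-- Leaf assignment of `NG2`. [folklore] -/
def actNG2 (i : ℕ) (k : ℕ) : ℕ :=
  [0, d.C.ge d.L i, d.M₁.Dc d.L i, d.Y.c i, d.E1.ge d.L i, d.E2s.ge d.L i, d.g₁, d.M₁.S.s i, d.c i, d.n i,
    d.C.ny i, d.C.ge d.L (i + 1), (d.M₁.D d.L).ny i, d.M₁.Dc d.L (i + 1), d.Y.s i, d.Y.c (i + 1), d.E1.ny i,
    d.E1.d d.L i, d.E1.ge d.L (i + 1), d.y1s i, d.E2s.ny i, d.E2s.ge d.L (i + 1)].getD k 0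

/-- **Sub-block 5**: the invariant lines of `NG2`. [cite: CookReckhow1979, §2] -/
theorem isBlock_sb5 (hG : ∀ r ∈ assocRules, r ∈ G.rules) (h : d.Avail K Γ) : G.IsBlock Γ (NG2.lines K d.actNG2 d.L) :=
  System.isBlock_lines assocLeavesOK.2.2.2.2.1 (hG _ (mem_assocRules (i := 12) (by decide)))
    (hG _ (mem_assocRules (i := 13) (by decide))) K d.actNG2 d.L
    (hcoh_of (p := fun k => decide (1 ≤ k ∧ k ≤ 6)) (by decide +kernel) fun i _ k hk => by
      simp only [decide_eq_true_eq] at hk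
      obtain ⟨hk₁, hk₂⟩ := hk
      interval_cases k <;> rfl)
    (fun φ hφ => by
      simp only [NG2, List.mem_cons, List.not_mem_nil, or_false] at hφ
      rcases hφ with rfl | rfl | rfl | rfl | rfl
      exacts [h.hC.2.1, h.hM₁.2.1.2.1, h.hY.1, h.hE1.2.1, h.hE2s.2.1])
    (fun i hi φ hφ => by
      simp only [NG2, List.mem_cons, List.not_mem_nil, or_false] at hφ
      rcases hφ with rfl | rfl | rfl | rfl | rfl | rfl | rfl | rfl | rfl | rfl | rfl | rfl
      exacts [h.hC.1 i hi, (h.hC.2.2 i hi).2, h.hM₁.2.1.1 i hi, (h.hM₁.2.1.2.2 i hi).2, (h.hY.2 i hi).1, (h.hY.2 i hi).2,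
        h.hE1.1 i hi, (h.hE1.2.2 i hi).1, (h.hE1.2.2 i hi).2, h.hy1s i hi, h.hE2s.1 i hi, (h.hE2s.2.2 i hi).2])

/-- Leaf assignment of `G1`. [folklore] -/
def actG1 (i : ℕ) (k : ℕ) : ℕ :=
  [0, d.M₁.Dc d.L i, d.Y.c i, d.E1.ge d.L i, d.M₁.S.s i, d.c i, d.n i, (d.M₁.D d.L).ny i, d.M₁.Dc d.L (i + 1),
    d.Y.s i, d.Y.c (i + 1), d.E1.ny i, d.E1.ge d.L (i + 1)].getD k 0

/-- **Sub-block 6**: the invariant lines of `G1`. [cite: CookReckhow1979, §2] -/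
theorem isBlock_sb6 (hG : ∀ r ∈ assocRules, r ∈ G.rules) (h : d.Avail K Γ) : G.IsBlock Γ (G1.lines K d.actG1 d.L) :=
  System.isBlock_lines assocLeavesOK.2.2.2.2.2.2.1 (hG _ (mem_assocRules (i := 18) (by decide)))
    (hG _ (mem_assocRules (i := 19) (by decide))) K d.actG1 d.L
    (hcoh_of (p := fun k => decide (1 ≤ k ∧ k ≤ 3)) (by decide +kernel) fun i _ k hk => by
      simp only [decide_eq_true_eq] at hk
      obtain ⟨hk₁, hk₂⟩ := hk
      interval_cases k <;> rfl)
    (fun φ hφ => by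
      simp only [G1, List.mem_cons, List.not_mem_nil, or_false] at hφ
      rcases hφ with rfl | rfl | rfl
      exacts [h.hM₁.2.1.2.1, h.hY.1, h.hE1.2.1])
    (fun i hi φ hφ => by
      simp only [G1, List.mem_cons, List.not_mem_nil, or_false] at hφ
      rcases hφ with rfl | rfl | rfl | rfl | rfl | rfl
      exacts [h.hM₁.2.1.1 i hi, (h.hM₁.2.1.2.2 i hi).2, (h.hY.2 i hi).1, (h.hY.2 i hi).2, h.hE1.1 i hi,
        (h.hE1.2.2 i hi).2])

/-- Leaf assignment of `NG2L`. [folklore] -/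
def actNG2L (i : ℕ) (k : ℕ) : ℕ :=
  [0, d.A.ge d.L i, d.M₃.Dc d.L i, d.AU.c i, d.E1.ge d.L i, d.E2s.ge d.L i, d.g₁, d.M₃.S.s i, d.a i, d.n i,
    d.A.ny i, d.A.ge d.L (i + 1), (d.M₃.D d.L).ny i, d.M₃.Dc d.L (i + 1), d.AU.s i, d.Y.s i, d.AU.c (i + 1),
    d.E1.ny i, d.E1.d d.L i, d.E1.ge d.L (i + 1), d.y1s i, d.E2s.ny i, d.E2s.ge d.L (i + 1)].getD k 0

/-- **Sub-block 7**: the invariant lines of `NG2L` (needs `Y ≡ AU` available). [cite: CookReckhow1979, §2] -/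
theorem isBlock_sb7 (hG : ∀ r ∈ assocRules, r ∈ G.rules) {T : Set (PropForm ℕ)} (h : d.Avail K T)
    (h₃ : ∀ i < d.L, ctx K (eqv (d.Y.s i) (d.AU.s i)) ∈ T) : G.IsBlock T (NG2L.lines K d.actNG2L d.L) :=
  System.isBlock_lines assocLeavesOK.2.2.2.2.2.1 (hG _ (mem_assocRules (i := 15) (by decide)))
    (hG _ (mem_assocRules (i := 16) (by decide))) K d.actNG2L d.L
    (hcoh_of (p := fun k => decide (1 ≤ k ∧ k ≤ 6)) (by decide +kernel) fun i _ k hk => by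
      simp only [decide_eq_true_eq] at hk
      obtain ⟨hk₁, hk₂⟩ := hk
      interval_cases k <;> rfl)
    (fun φ hφ => by
      simp only [NG2L, List.mem_cons, List.not_mem_nil, or_false] at hφ
      rcases hφ with rfl | rfl | rfl | rfl | rfl
      exacts [h.hA.2.1, h.hM₃.2.1.2.1, h.hAU.1, h.hE1.2.1, h.hE2s.2.1])
    (fun i hi φ hφ => by
      simp only [NG2L, List.mem_cons, List.not_mem_nil, or_false] at hφ
      rcases hφ with rfl | rfl | rfl | rfl | rfl | rfl | rfl | rfl | rfl | rfl | rfl | rfl | rfl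
      exacts [h.hA.1 i hi, (h.hA.2.2 i hi).2, h.hM₃.2.1.1 i hi, (h.hM₃.2.1.2.2 i hi).2, (h.hAU.2 i hi).1, h₃ i hi,
        (h.hAU.2 i hi).2, h.hE1.1 i hi, (h.hE1.2.2 i hi).1, (h.hE1.2.2 i hi).2, h.hy1s i hi, h.hE2s.1 i hi,
        (h.hE2s.2.2 i hi).2])

/-- Leaf assignment of `G1L`. [folklore] -/
def actG1L (i : ℕ) (k : ℕ) : ℕ :=
  [0, d.M₃.Dc d.L i, d.AU.c i, d.E1.ge d.L i, d.M₃.S.s i, d.a i, d.n i, (d.M₃.D d.L).ny i, d.M₃.Dc d.L (i + 1),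
    d.AU.s i, d.Y.s i, d.AU.c (i + 1), d.E1.ny i, d.E1.ge d.L (i + 1)].getD k 0

/-- **Sub-block 8**: the invariant lines of `G1L` (needs `Y ≡ AU` available). [cite: CookReckhow1979, §2] -/
theorem isBlock_sb8 (hG : ∀ r ∈ assocRules, r ∈ G.rules) {T : Set (PropForm ℕ)} (h : d.Avail K T)
    (h₃ : ∀ i < d.L, ctx K (eqv (d.Y.s i) (d.AU.s i)) ∈ T) : G.IsBlock T (G1L.lines K d.actG1L d.L) :=
  System.isBlock_lines assocLeavesOK.2.2.2.2.2.2.2 (hG _ (mem_assocRules (i := 21) (by decide)))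
    (hG _ (mem_assocRules (i := 22) (by decide))) K d.actG1L d.L
    (hcoh_of (p := fun k => decide (1 ≤ k ∧ k ≤ 3)) (by decide +kernel) fun i _ k hk => by
      simp only [decide_eq_true_eq] at hk
      obtain ⟨hk₁, hk₂⟩ := hk
      interval_cases k <;> rfl)
    (fun φ hφ => by
      simp only [G1L, List.mem_cons, List.not_mem_nil, or_false] at hφ
      rcases hφ with rfl | rfl | rfl
      exacts [h.hM₃.2.1.2.1, h.hAU.1, h.hE1.2.1])
    (fun i hi φ hφ => by
      simp only [G1L, List.mem_cons, List.not_mem_nil, or_false] at hφ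
      rcases hφ with rfl | rfl | rfl | rfl | rfl | rfl | rfl
      exacts [h.hM₃.2.1.1 i hi, (h.hM₃.2.1.2.2 i hi).2, (h.hAU.2 i hi).1, h₃ i hi, (h.hAU.2 i hi).2, h.hE1.1 i hi,
        (h.hE1.2.2 i hi).2])

/-! ### Bookkeeping: the top carries of `Y` and `AU` are false -/

/-- The bookkeeping lines: `¬c_{L-1}(S₁)`, `¬s_{L-1}(S₁)`, `¬c_L(Y)`, `¬c_{L-1}(S₃)`, `¬s_{L-1}(S₃)`,
`¬c_L(AU)`. [folklore] -/
def bookLines (K : PropForm ℕ) : List (PropForm ℕ) :=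
  [ctx K (neg (var (d.M₁.S.c (d.L - 1)))), ctx K (neg (var (d.M₁.S.s (d.L - 1)))), ctx K (neg (var (d.Y.c d.L))),
    ctx K (neg (var (d.M₃.S.c (d.L - 1)))), ctx K (neg (var (d.M₃.S.s (d.L - 1)))), ctx K (neg (var (d.AU.c d.L)))]

/-- **Bookkeeping**: if the operand bits are provably false from position `m` on and
`m + 2 ≤ L` (the words are `< 2^m`, e.g. zero-extended inputs, or words `< n` with `n < 2^m`),
then the adders `Y = S₁ + c` and `AU = a + S₃` have no carry at `L`. [cite: CookReckhow1979, §2] -/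
theorem isBlock_bookLines (hGG : ∀ r ∈ glueRules, r ∈ G.rules) (h : d.Avail K Γ) {m : ℕ} (hm : m + 2 ≤ d.L)
    (haf : ∀ i, m ≤ i → i < d.L → ctx K (neg (var (d.a i))) ∈ Γ)
    (hbf : ∀ i, m ≤ i → i < d.L → ctx K (neg (var (d.b i))) ∈ Γ)
    (hcf : ∀ i, m ≤ i → i < d.L → ctx K (neg (var (d.c i))) ∈ Γ) : G.IsBlock Γ (d.bookLines K) := by
  have hL : d.L - 2 + 1 = d.L - 1 := by omega
  have hL' : d.L - 1 + 1 = d.L := by omega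
  -- the definition lines at the top positions, with normalised indices
  have e₁ : ctx K (biimp (var (d.M₁.S.c (d.L - 1))) (majF (var (d.a (d.L - 2))) (var (d.b (d.L - 2)))
      (var (d.M₁.S.c (d.L - 2))))) ∈ Γ := by
    have := (h.hM₁.1.2 (d.L - 2) (by omega)).2; simp only [Adder.View.carryDef, hL] at this; exact this
  have e₂ : ctx K (biimp (var (d.M₁.S.s (d.L - 1))) (xor3F (var (d.a (d.L - 1))) (var (d.b (d.L - 1)))
      (var (d.M₁.S.c (d.L - 1))))) ∈ Γ := (h.hM₁.1.2 (d.L - 1) (by omega)).1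
  have e₃ : ctx K (biimp (var (d.Y.c d.L)) (majF (var (d.M₁.S.s (d.L - 1))) (var (d.c (d.L - 1)))
      (var (d.Y.c (d.L - 1))))) ∈ Γ := by
    have := (h.hY.2 (d.L - 1) (by omega)).2; simp only [Adder.View.carryDef, hL'] at this; exact this
  have e₄ : ctx K (biimp (var (d.M₃.S.c (d.L - 1))) (majF (var (d.b (d.L - 2))) (var (d.c (d.L - 2)))
      (var (d.M₃.S.c (d.L - 2))))) ∈ Γ := by
    have := (h.hM₃.1.2 (d.L - 2) (by omega)).2; simp only [Adder.View.carryDef, hL] at this; exact this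
  have e₅ : ctx K (biimp (var (d.M₃.S.s (d.L - 1))) (xor3F (var (d.b (d.L - 1))) (var (d.c (d.L - 1)))
      (var (d.M₃.S.c (d.L - 1))))) ∈ Γ := (h.hM₃.1.2 (d.L - 1) (by omega)).1
  have e₆ : ctx K (biimp (var (d.AU.c d.L)) (majF (var (d.a (d.L - 1))) (var (d.M₃.S.s (d.L - 1)))
      (var (d.AU.c (d.L - 1))))) ∈ Γ := by
    have := (h.hAU.2 (d.L - 1) (by omega)).2; simp only [Adder.View.carryDef, hL'] at this; exact this
  refine FregeSystem.IsBlock.cons (Or.inr (glue hGG 0 (by decide)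
    (FregeSystem.sub [K, var (d.M₁.S.c (d.L - 1)), var (d.a (d.L - 2)), var (d.b (d.L - 2)), var (d.M₁.S.c (d.L - 2))])
    rfl (FregeSystem.prems_cons e₁ (FregeSystem.prems_cons (haf _ (by omega) (by omega))
      (FregeSystem.prems_cons (hbf _ (by omega) (by omega)) FregeSystem.prems_nil))))) ?_
  refine FregeSystem.IsBlock.cons (Or.inr (glue hGG 1 (by decide)
    (FregeSystem.sub [K, var (d.M₁.S.s (d.L - 1)), var (d.a (d.L - 1)), var (d.b (d.L - 1)), var (d.M₁.S.c (d.L - 1))])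
    rfl (FregeSystem.prems_cons (Or.inl e₂) (FregeSystem.prems_cons (Or.inl (haf _ (by omega) (by omega)))
      (FregeSystem.prems_cons (Or.inl (hbf _ (by omega) (by omega))) (FregeSystem.prems_cons (Or.inr rfl)
      FregeSystem.prems_nil)))))) ?_
  refine FregeSystem.IsBlock.cons (Or.inr (glue hGG 0 (by decide)
    (FregeSystem.sub [K, var (d.Y.c d.L), var (d.M₁.S.s (d.L - 1)), var (d.c (d.L - 1)), var (d.Y.c (d.L - 1))])
    rfl (FregeSystem.prems_cons (Or.inl (Or.inl e₃)) (FregeSystem.prems_cons (Or.inr rfl)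
      (FregeSystem.prems_cons (Or.inl (Or.inl (hcf _ (by omega) (by omega)))) FregeSystem.prems_nil))))) ?_
  refine FregeSystem.IsBlock.cons (Or.inr (glue hGG 0 (by decide)
    (FregeSystem.sub [K, var (d.M₃.S.c (d.L - 1)), var (d.b (d.L - 2)), var (d.c (d.L - 2)), var (d.M₃.S.c (d.L - 2))])
    rfl (FregeSystem.prems_cons (Or.inl (Or.inl (Or.inl e₄)))
      (FregeSystem.prems_cons (Or.inl (Or.inl (Or.inl (hbf _ (by omega) (by omega)))))
      (FregeSystem.prems_cons (Or.inl (Or.inl (Or.inl (hcf _ (by omega) (by omega))))) FregeSystem.prems_nil))))) ?_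
  refine FregeSystem.IsBlock.cons (Or.inr (glue hGG 1 (by decide)
    (FregeSystem.sub [K, var (d.M₃.S.s (d.L - 1)), var (d.b (d.L - 1)), var (d.c (d.L - 1)), var (d.M₃.S.c (d.L - 1))])
    rfl (FregeSystem.prems_cons (Or.inl (Or.inl (Or.inl (Or.inl e₅))))
      (FregeSystem.prems_cons (Or.inl (Or.inl (Or.inl (Or.inl (hbf _ (by omega) (by omega))))))
      (FregeSystem.prems_cons (Or.inl (Or.inl (Or.inl (Or.inl (hcf _ (by omega) (by omega))))))
      (FregeSystem.prems_cons (Or.inr rfl) FregeSystem.prems_nil)))))) ?_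
  exact FregeSystem.IsBlock.singleton (Or.inr (glue hGG 0 (by decide)
    (FregeSystem.sub [K, var (d.AU.c d.L), var (d.a (d.L - 1)), var (d.M₃.S.s (d.L - 1)), var (d.AU.c (d.L - 1))])
    rfl (FregeSystem.prems_cons (Or.inl (Or.inl (Or.inl (Or.inl (Or.inl e₆)))))
      (FregeSystem.prems_cons (Or.inl (Or.inl (Or.inl (Or.inl (Or.inl (haf _ (by omega) (by omega)))))))
      (FregeSystem.prems_cons (Or.inr rfl) FregeSystem.prems_nil)))))

/-- The bookkeeping conclusions. [folklore] -/
theorem mem_bookLines : ctx K (neg (var (d.Y.c d.L))) ∈ d.bookLines K ∧ ctx K (neg (var (d.AU.c d.L))) ∈ d.bookLines K := by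
  simp [bookLines]

/-- Size of the bookkeeping lines. [folklore] -/
theorem proofSize_bookLines : proofSize (d.bookLines K) = 6 * (K.size + 3) := by
  simp [bookLines, proofSize, ctx, size]; ring

/-! ### Generic: a block given as a list of segments -/

/-- **Segmented blocks**: if every segment is a block over `T` enlarged by the earlier segments,
the concatenation is a block over `T`. [folklore] -/
theorem isBlock_flatten {T : Set (PropForm ℕ)} (segs : List (List (PropForm ℕ)))
    (h : ∀ k (hk : k < segs.length), G.IsBlock (T ∪ {χ | ∃ j, ∃ hj : j < k, χ ∈ segs[j]}) segs[k]) :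
    G.IsBlock T segs.flatten := by
  suffices H : ∀ k ≤ segs.length, G.IsBlock T (segs.take k).flatten by simpa using H segs.length le_rfl
  intro k hk
  induction k with
  | zero => simp [FregeSystem.IsBlock.nil]
  | succ k ih =>
    rw [List.take_add_one, List.flatten_append]
    refine (ih (by omega)).append ?_
    rw [List.getElem?_eq_getElem (by omega)]
    simp only [Option.toList_some, List.flatten_cons, List.flatten_nil, List.append_nil]
    refine (h k (by omega)).mono (Set.union_subset_union_right _ fun χ hχ => ?_)
    obtain ⟨j, hj, hχ⟩ := hχ
    simp only [Set.mem_setOf_eq, List.mem_flatten, List.mem_take_iff_getElem]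
    exact ⟨segs[j], ⟨j, by omega, rfl⟩, hχ⟩

/-! ### Count T: `ge₁ + ge₂ = g₁ + g₂` by cases on `ge₁` -/

/-- The context of the positive branch (`ge₁` assumed). [folklore] -/
def KT (K : PropForm ℕ) : PropForm ℕ := disj K (neg (var (d.M₁.ge d.L)))
/-- The context of the negative branch (`¬ge₁` assumed). [folklore] -/
def KF (K : PropForm ℕ) : PropForm ℕ := disj K (var (d.M₁.ge d.L))

/-- The lines weakened into the positive branch. [folklore] -/
def wkT : List (PropForm ℕ) :=
  [inst (d.actG1 d.L) G1.inv, neg (var (d.Y.c d.L)), eqv (d.M₂.ge d.L) (d.E2T.ge d.L d.L)] ++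
    (muxDefList d.y1T (d.M₁.ge d.L) (d.E1.d d.L) d.Y.s d.L ++ (muxDefList d.y1s d.g₁ (d.E1.d d.L) d.Y.s d.L ++
      (subDefList d.E2T d.L ++ subDefList d.E2s d.L)))

/-- The segments of the positive branch of count T. [folklore] -/
def segsT (K : PropForm ℕ) : List (List (PropForm ℕ)) :=
  [[ctx (d.KT K) (var (d.M₁.ge d.L))],
   Logic.weakLines K (neg (var (d.M₁.ge d.L))) d.wkT,
   (List.range d.L).map (fun i => ctx (d.KT K) (eqv (d.y1T i) (d.E1.d d.L i))),
   [ctx (d.KT K) (var d.g₁)],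
   (List.range d.L).map (fun i => ctx (d.KT K) (eqv (d.y1s i) (d.E1.d d.L i))),
   (List.range d.L).map (fun i => ctx (d.KT K) (eqv (d.y1T i) (d.y1s i))),
   Adder.reflLines (d.KT K) ((List.range d.L).map d.n),
   Sub.leibLines d.E2T d.E2s (d.KT K) d.L,
   [ctx (d.KT K) (eqv (d.M₂.ge d.L) d.g₂)],
   [ctx (d.KT K) (Adder.invF (var (d.M₁.ge d.L)) (var (d.M₂.ge d.L)) (var d.g₁) (var d.g₂))]]

/-- **Count T, positive branch**: under `ge₁`, `g₁` holds (system `G1`), `y1T ≡ E1.d ≡ y1s`,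
`E2T ≡ E2s`, so `ge₂ ↔ g₂` and `ge₁ + ge₂ = g₁ + g₂`. [cite: CookReckhow1979, §2] -/
theorem isBlock_segsT (hG : ∀ r ∈ assocRules, r ∈ G.rules) (hGN : ∀ r ∈ Netlist.rules, r ∈ G.rules)
    (hGA : ∀ r ∈ Adder.rules, r ∈ G.rules) (hGL : ∀ r ∈ Logic.rules, r ∈ G.rules)
    (hGG : ∀ r ∈ glueRules, r ∈ G.rules) {T : Set (PropForm ℕ)} (h : d.Avail K T)
    (hinv : G1.line K d.actG1 d.L ∈ T) (hY : ctx K (neg (var (d.Y.c d.L))) ∈ T)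
    (hge : ctx K (eqv (d.M₂.ge d.L) (d.E2T.ge d.L d.L)) ∈ T) : G.IsBlock T (d.segsT K).flatten := by
  have hwk : ∀ θ ∈ d.wkT, ctx K θ ∈ T := by
    intro θ hθ
    simp only [wkT, List.mem_append, List.mem_cons, List.not_mem_nil, or_false] at hθ
    rcases hθ with (rfl | rfl | rfl) | hθ | hθ | hθ | hθ
    · exact hinv
    · exact hY
    · exact hge
    · obtain ⟨i, hi, rfl⟩ := List.mem_map.1 hθ; exact h.hy1T i (List.mem_range.1 hi)
    · obtain ⟨i, hi, rfl⟩ := List.mem_map.1 hθ; exact h.hy1s i (List.mem_range.1 hi)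
    · exact forall_of_subAvail h.hE2T θ hθ
    · exact forall_of_subAvail h.hE2s θ hθ
  have w₁ : ∀ {i}, i < d.L → muxLine (d.y1T i) (d.M₁.ge d.L) (d.E1.d d.L i) (d.Y.s i) ∈ d.wkT := fun hi =>
    List.mem_append_right _ (List.mem_append_left _ (mem_muxDefList hi))
  have w₂ : ∀ {i}, i < d.L → muxLine (d.y1s i) d.g₁ (d.E1.d d.L i) (d.Y.s i) ∈ d.wkT := fun hi =>
    List.mem_append_right _ (List.mem_append_right _ (List.mem_append_left _ (mem_muxDefList hi)))
  have w₃ : ∀ θ ∈ subDefList d.E2T d.L, θ ∈ d.wkT := fun θ hθ =>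
    List.mem_append_right _ (List.mem_append_right _ (List.mem_append_right _ (List.mem_append_left _ hθ)))
  have w₄ : ∀ θ ∈ subDefList d.E2s d.L, θ ∈ d.wkT := fun θ hθ =>
    List.mem_append_right _ (List.mem_append_right _ (List.mem_append_right _ (List.mem_append_right _ hθ)))
  refine isBlock_flatten _ fun k hk => ?_
  simp only [segsT, List.length_cons, List.length_nil] at hk
  -- abbreviation for the growing set
  have mem : ∀ {χ} (j : ℕ) (hj : j < k) (hχ : χ ∈ (d.segsT K)[j]'(by simp [segsT]; omega)),
      χ ∈ T ∪ {χ | ∃ j, ∃ hj : j < k, χ ∈ (d.segsT K)[j]'(by simp [segsT]; omega)} := fun j hj hχ => Or.inr ⟨j, hj, hχ⟩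
  have k₀ : inst (d.actG1 d.L) G1.inv ∈ d.wkT := List.mem_append_left _ (List.mem_cons.2 (Or.inl rfl))
  have k₁ : inst (d.actG1 d.L) (neg (var 2)) ∈ d.wkT :=
    List.mem_append_left _ (List.mem_cons.2 (Or.inr (List.mem_cons.2 (Or.inl rfl))))
  have k₂ : eqv (d.M₂.ge d.L) (d.E2T.ge d.L d.L) ∈ d.wkT :=
    List.mem_append_left _ (List.mem_cons.2 (Or.inr (List.mem_cons.2 (Or.inr (List.mem_cons.2 (Or.inl rfl))))))
  interval_cases k
  · -- 0: the case hypothesis `ge₁`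
    exact FregeSystem.IsBlock.singleton (Or.inr (Logic.infer hGL 1 (by decide)
      (FregeSystem.sub [K, var (d.M₁.ge d.L)]) rfl FregeSystem.prems_nil))
  · -- 1: weakening
    exact Logic.isBlock_weakLines hGL K _ fun L hL => Or.inl (hwk L hL)
  · -- 2: `y1T ≡ E1.d`
    refine Scaffold.isBlock_of_forall fun θ hθ => ?_
    obtain ⟨i, hi, rfl⟩ := List.mem_map.1 hθ
    rw [List.mem_range] at hi
    exact Or.inr (Logic.infer hGL 13 (by decide)
      (FregeSystem.sub [d.KT K, var (d.y1T i), var (d.M₁.ge d.L), var (d.E1.d d.L i), var (d.Y.s i)]) rfl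
      (FregeSystem.prems_cons (mem 1 (by omega) (Logic.mem_weakLines (w₁ hi)))
        (FregeSystem.prems_cons (mem 0 (by omega) (List.mem_singleton_self _)) FregeSystem.prems_nil)))
  · -- 3: `g₁` by the end rule of `G1`
    exact FregeSystem.IsBlock.singleton (Or.inr (System.isInferredFrom_end assocLeavesOK.2.2.2.2.2.2.1.inv_ne_zero
      (hG _ (mem_assocRules (i := 20) (by decide))) (System.forall_ne_zero_of_shapesOKB (by decide +kernel))
      (ne_zero_of_allVarsB (by decide +kernel)) (d.KT K) d.actG1 d.L
      (mem 1 (by omega) (Logic.mem_weakLines k₀)) fun φ hφ => by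
        simp only [List.mem_cons, List.not_mem_nil, or_false] at hφ
        rcases hφ with rfl | rfl
        exacts [mem 0 (by omega) (List.mem_singleton_self _), mem 1 (by omega) (Logic.mem_weakLines k₁)]))
  · -- 4: `y1s ≡ E1.d`
    refine Scaffold.isBlock_of_forall fun θ hθ => ?_
    obtain ⟨i, hi, rfl⟩ := List.mem_map.1 hθ
    rw [List.mem_range] at hi
    exact Or.inr (Logic.infer hGL 13 (by decide)
      (FregeSystem.sub [d.KT K, var (d.y1s i), var d.g₁, var (d.E1.d d.L i), var (d.Y.s i)]) rfl
      (FregeSystem.prems_cons (mem 1 (by omega) (Logic.mem_weakLines (w₂ hi)))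
        (FregeSystem.prems_cons (mem 3 (by omega) (List.mem_singleton_self _)) FregeSystem.prems_nil)))
  · -- 5: `y1T ≡ y1s`
    refine Scaffold.isBlock_of_forall fun θ hθ => ?_
    obtain ⟨i, hi, rfl⟩ := List.mem_map.1 hθ
    rw [List.mem_range] at hi
    exact Or.inr (glue hGG 2 (by decide) (FregeSystem.sub [d.KT K, var (d.y1T i), var (d.E1.d d.L i), var (d.y1s i)]) rfl
      (FregeSystem.prems_cons (mem 2 (by omega) (List.mem_map.2 ⟨i, List.mem_range.2 hi, rfl⟩))
        (FregeSystem.prems_cons (mem 4 (by omega) (List.mem_map.2 ⟨i, List.mem_range.2 hi, rfl⟩)) FregeSystem.prems_nil)))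
  · -- 6: reflexivity of `n`
    exact Adder.isBlock_reflLines hGA _ _ _
  · -- 7: `E2T ≡ E2s`
    exact Sub.isBlock_leibLines hGN hGL _ _
      (subAvail_of_forall fun θ hθ => mem 1 (by omega) (Logic.mem_weakLines (w₃ θ hθ)))
      (subAvail_of_forall fun θ hθ => mem 1 (by omega) (Logic.mem_weakLines (w₄ θ hθ)))
      (fun i hi => mem 5 (by omega) (List.mem_map.2 ⟨i, List.mem_range.2 hi, rfl⟩))
      (fun i hi => mem 6 (by omega) (Adder.mem_reflLines (List.mem_map.2 ⟨i, List.mem_range.2 hi, rfl⟩)))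
  · -- 8: `ge₂ ↔ g₂`
    exact FregeSystem.IsBlock.singleton (Or.inr (Logic.infer hGL 6 (by decide)
      (FregeSystem.sub [d.KT K, var (d.M₂.ge d.L), var (d.E2T.ge d.L d.L), var d.g₂]) rfl
      (FregeSystem.prems_cons (mem 1 (by omega) (Logic.mem_weakLines k₂))
        (FregeSystem.prems_cons (mem 7 (by omega) (Sub.mem_leibLines (k := 2 * d.L) (by omega))) FregeSystem.prems_nil))))
  · -- 9: counting
    exact FregeSystem.IsBlock.singleton (Or.inr (glue hGG 4 (by decide)
      (FregeSystem.sub [d.KT K, var (d.M₁.ge d.L), var (d.M₂.ge d.L), var d.g₁, var d.g₂]) rfl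
      (FregeSystem.prems_cons (mem 0 (by omega) (List.mem_singleton_self _))
        (FregeSystem.prems_cons (mem 3 (by omega) (List.mem_singleton_self _))
        (FregeSystem.prems_cons (mem 8 (by omega) (List.mem_singleton_self _)) FregeSystem.prems_nil)))))

/-- The lines weakened into the negative branch. [folklore] -/
def wkF : List (PropForm ℕ) :=
  [inst (d.actNG2 d.L) NG2.inv, neg (var (d.C.ge d.L d.L)), eqv (d.M₂.ge d.L) (d.E2T.ge d.L d.L)] ++
    (muxDefList d.y1T (d.M₁.ge d.L) (d.E1.d d.L) d.Y.s d.L ++ (subDefList d.E2T d.L ++ subDefList d.E1 d.L))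

/-- The segments of the negative branch of count T. [folklore] -/
def segsF (K : PropForm ℕ) : List (List (PropForm ℕ)) :=
  [[ctx (d.KF K) (neg (var (d.M₁.ge d.L)))],
   Logic.weakLines K (var (d.M₁.ge d.L)) d.wkF,
   (List.range d.L).map (fun i => ctx (d.KF K) (eqv (d.y1T i) (d.Y.s i))),
   Adder.reflLines (d.KF K) ((List.range d.L).map d.n ++ [d.g₁]),
   Sub.leibLines d.E2T d.E1 (d.KF K) d.L,
   [ctx (d.KF K) (eqv (d.M₂.ge d.L) d.g₁)],
   [ctx (d.KF K) (neg (var d.g₂))],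
   [ctx (d.KF K) (Adder.invF (var (d.M₁.ge d.L)) (var (d.M₂.ge d.L)) (var d.g₁) (var d.g₂))]]

/-- **Count T, negative branch**: under `¬ge₁`, `y1T ≡ Y`, `E2T ≡ E1`, so `ge₂ ↔ g₁`; `¬g₂` by the
end rule of `NG2`; hence `ge₁ + ge₂ = g₁ + g₂`. [cite: CookReckhow1979, §2] -/
theorem isBlock_segsF (hG : ∀ r ∈ assocRules, r ∈ G.rules) (hGN : ∀ r ∈ Netlist.rules, r ∈ G.rules)
    (hGA : ∀ r ∈ Adder.rules, r ∈ G.rules) (hGL : ∀ r ∈ Logic.rules, r ∈ G.rules)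
    (hGG : ∀ r ∈ glueRules, r ∈ G.rules) {T : Set (PropForm ℕ)} (h : d.Avail K T)
    (hinv : NG2.line K d.actNG2 d.L ∈ T) (hC : ctx K (neg (var (d.C.ge d.L d.L))) ∈ T)
    (hge : ctx K (eqv (d.M₂.ge d.L) (d.E2T.ge d.L d.L)) ∈ T) : G.IsBlock T (d.segsF K).flatten := by
  have hwk : ∀ θ ∈ d.wkF, ctx K θ ∈ T := by
    intro θ hθ
    simp only [wkF, List.mem_append, List.mem_cons, List.not_mem_nil, or_false] at hθ
    rcases hθ with (rfl | rfl | rfl) | hθ | hθ | hθ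
    · exact hinv
    · exact hC
    · exact hge
    · obtain ⟨i, hi, rfl⟩ := List.mem_map.1 hθ; exact h.hy1T i (List.mem_range.1 hi)
    · exact forall_of_subAvail h.hE2T θ hθ
    · exact forall_of_subAvail h.hE1 θ hθ
  have w₁ : ∀ {i}, i < d.L → muxLine (d.y1T i) (d.M₁.ge d.L) (d.E1.d d.L i) (d.Y.s i) ∈ d.wkF := fun hi =>
    List.mem_append_right _ (List.mem_append_left _ (mem_muxDefList hi))
  have w₃ : ∀ θ ∈ subDefList d.E2T d.L, θ ∈ d.wkF := fun θ hθ =>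
    List.mem_append_right _ (List.mem_append_right _ (List.mem_append_left _ hθ))
  have w₄ : ∀ θ ∈ subDefList d.E1 d.L, θ ∈ d.wkF := fun θ hθ =>
    List.mem_append_right _ (List.mem_append_right _ (List.mem_append_right _ hθ))
  refine isBlock_flatten _ fun k hk => ?_
  simp only [segsF, List.length_cons, List.length_nil] at hk
  have mem : ∀ {χ} (j : ℕ) (hj : j < k) (hχ : χ ∈ (d.segsF K)[j]'(by simp [segsF]; omega)),
      χ ∈ T ∪ {χ | ∃ j, ∃ hj : j < k, χ ∈ (d.segsF K)[j]'(by simp [segsF]; omega)} := fun j hj hχ => Or.inr ⟨j, hj, hχ⟩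
  have k₀ : inst (d.actNG2 d.L) NG2.inv ∈ d.wkF := List.mem_append_left _ (List.mem_cons.2 (Or.inl rfl))
  have k₁ : inst (d.actNG2 d.L) (neg (var 1)) ∈ d.wkF :=
    List.mem_append_left _ (List.mem_cons.2 (Or.inr (List.mem_cons.2 (Or.inl rfl))))
  have k₂ : eqv (d.M₂.ge d.L) (d.E2T.ge d.L d.L) ∈ d.wkF :=
    List.mem_append_left _ (List.mem_cons.2 (Or.inr (List.mem_cons.2 (Or.inr (List.mem_cons.2 (Or.inl rfl))))))
  interval_cases k
  · -- 0: the case hypothesis `¬ge₁`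
    exact FregeSystem.IsBlock.singleton (Or.inr (Logic.infer hGL 2 (by decide)
      (FregeSystem.sub [K, var (d.M₁.ge d.L)]) rfl FregeSystem.prems_nil))
  · -- 1: weakening
    exact Logic.isBlock_weakLines hGL K _ fun L hL => Or.inl (hwk L hL)
  · -- 2: `y1T ≡ Y`
    refine Scaffold.isBlock_of_forall fun θ hθ => ?_
    obtain ⟨i, hi, rfl⟩ := List.mem_map.1 hθ
    rw [List.mem_range] at hi
    exact Or.inr (Logic.infer hGL 14 (by decide)
      (FregeSystem.sub [d.KF K, var (d.y1T i), var (d.M₁.ge d.L), var (d.E1.d d.L i), var (d.Y.s i)]) rfl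
      (FregeSystem.prems_cons (mem 1 (by omega) (Logic.mem_weakLines (w₁ hi)))
        (FregeSystem.prems_cons (mem 0 (by omega) (List.mem_singleton_self _)) FregeSystem.prems_nil)))
  · -- 3: reflexivity of `n` and `g₁`
    exact Adder.isBlock_reflLines hGA _ _ _
  · -- 4: `E2T ≡ E1`
    exact Sub.isBlock_leibLines hGN hGL _ _
      (subAvail_of_forall fun θ hθ => mem 1 (by omega) (Logic.mem_weakLines (w₃ θ hθ)))
      (subAvail_of_forall fun θ hθ => mem 1 (by omega) (Logic.mem_weakLines (w₄ θ hθ)))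
      (fun i hi => mem 2 (by omega) (List.mem_map.2 ⟨i, List.mem_range.2 hi, rfl⟩))
      (fun i hi => mem 3 (by omega) (Adder.mem_reflLines (List.mem_append_left _
        (List.mem_map.2 ⟨i, List.mem_range.2 hi, rfl⟩))))
  · -- 5: `ge₂ ↔ g₁`
    exact FregeSystem.IsBlock.singleton (Or.inr (Logic.infer hGL 6 (by decide)
      (FregeSystem.sub [d.KF K, var (d.M₂.ge d.L), var (d.E2T.ge d.L d.L), var d.g₁]) rfl
      (FregeSystem.prems_cons (mem 1 (by omega) (Logic.mem_weakLines k₂))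
        (FregeSystem.prems_cons (mem 4 (by omega) (Sub.mem_leibLines (k := 2 * d.L) (by omega))) FregeSystem.prems_nil))))
  · -- 6: `¬g₂` by the end rule of `NG2`
    exact FregeSystem.IsBlock.singleton (Or.inr (System.isInferredFrom_end assocLeavesOK.2.2.2.2.1.inv_ne_zero
      (hG _ (mem_assocRules (i := 14) (by decide))) (System.forall_ne_zero_of_shapesOKB (by decide +kernel))
      (ne_zero_of_allVarsB (by decide +kernel)) (d.KF K) d.actNG2 d.L
      (mem 1 (by omega) (Logic.mem_weakLines k₀)) fun φ hφ => by
        simp only [List.mem_cons, List.not_mem_nil, or_false] at hφ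
        rcases hφ with rfl | rfl | rfl
        exacts [mem 1 (by omega) (Logic.mem_weakLines k₁), mem 0 (by omega) (List.mem_singleton_self _),
          mem 3 (by omega) (Adder.mem_reflLines (List.mem_append_right _ (List.mem_singleton_self _)))]))
  · -- 7: counting
    exact FregeSystem.IsBlock.singleton (Or.inr (glue hGG 3 (by decide)
      (FregeSystem.sub [d.KF K, var (d.M₁.ge d.L), var (d.M₂.ge d.L), var d.g₁, var d.g₂]) rfl
      (FregeSystem.prems_cons (mem 0 (by omega) (List.mem_singleton_self _))
        (FregeSystem.prems_cons (mem 5 (by omega) (List.mem_singleton_self _))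
        (FregeSystem.prems_cons (mem 6 (by omega) (List.mem_singleton_self _)) FregeSystem.prems_nil)))))

/-- The lines of count T: both branches, then the merged count. [folklore] -/
def countT (K : PropForm ℕ) : List (PropForm ℕ) :=
  (d.segsT K).flatten ++ (d.segsF K).flatten ++
    Logic.mergeLines K [Adder.invF (var (d.M₁.ge d.L)) (var (d.M₂.ge d.L)) (var d.g₁) (var d.g₂)]

/-- **Count T**: `ge₁ + ge₂ = g₁ + g₂`. [cite: CookReckhow1979, §2] -/
theorem isBlock_countT (hG : ∀ r ∈ assocRules, r ∈ G.rules) (hGN : ∀ r ∈ Netlist.rules, r ∈ G.rules)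
    (hGA : ∀ r ∈ Adder.rules, r ∈ G.rules) (hGL : ∀ r ∈ Logic.rules, r ∈ G.rules)
    (hGG : ∀ r ∈ glueRules, r ∈ G.rules) {T : Set (PropForm ℕ)} (h : d.Avail K T)
    (hinv₁ : G1.line K d.actG1 d.L ∈ T) (hinv₂ : NG2.line K d.actNG2 d.L ∈ T) (hY : ctx K (neg (var (d.Y.c d.L))) ∈ T)
    (hC : ctx K (neg (var (d.C.ge d.L d.L))) ∈ T) (hge : ctx K (eqv (d.M₂.ge d.L) (d.E2T.ge d.L d.L)) ∈ T) :
    G.IsBlock T (d.countT K) := by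
  refine Logic.isBlock_cases (A := var (d.M₁.ge d.L)) hGL (d.isBlock_segsT hG hGN hGA hGL hGG h hinv₁ hY hge)
    ((d.isBlock_segsF hG hGN hGA hGL hGG h hinv₂ hC hge).mono Set.subset_union_left) (fun L hL => ?_) fun L hL => ?_
  · rw [List.mem_singleton.1 hL]
    refine Or.inl (Or.inr ?_)
    simp only [Set.mem_setOf_eq, segsT, List.flatten_cons, List.flatten_nil, List.mem_append, List.mem_singleton]
    exact Or.inr (Or.inr (Or.inr (Or.inr (Or.inr (Or.inr (Or.inr (Or.inr (Or.inr (Or.inl rfl)))))))))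
  · rw [List.mem_singleton.1 hL]
    refine Or.inr ?_
    simp only [Set.mem_setOf_eq, segsF, List.flatten_cons, List.flatten_nil, List.mem_append, List.mem_singleton]
    exact Or.inr (Or.inr (Or.inr (Or.inr (Or.inr (Or.inr (Or.inr (Or.inl rfl)))))))

/-- The conclusion of count T. [folklore] -/
theorem mem_countT : ctx K (Adder.invF (var (d.M₁.ge d.L)) (var (d.M₂.ge d.L)) (var d.g₁) (var d.g₂)) ∈ d.countT K :=
  List.mem_append_right _ (List.mem_singleton_self _)

/-! ### Count V: `ge₃ + ge₄ = g₁ + g₂` by cases on `ge₃` -/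

/-- The context of the positive branch (`ge₃` assumed). [folklore] -/
def KT' (K : PropForm ℕ) : PropForm ℕ := disj K (neg (var (d.M₃.ge d.L)))
/-- The context of the negative branch (`¬ge₃` assumed). [folklore] -/
def KF' (K : PropForm ℕ) : PropForm ℕ := disj K (var (d.M₃.ge d.L))

/-- The lines weakened into the positive branch. [folklore] -/
def wkT' : List (PropForm ℕ) :=
  [inst (d.actG1L d.L) G1L.inv, neg (var (d.AU.c d.L)), eqv (d.M₄.ge d.L) (d.E2V.ge d.L d.L)] ++
    (muxDefList d.y1V (d.M₃.ge d.L) (d.E1.d d.L) d.Y.s d.L ++ (muxDefList d.y1s d.g₁ (d.E1.d d.L) d.Y.s d.L ++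
      (subDefList d.E2V d.L ++ subDefList d.E2s d.L)))

/-- The segments of the positive branch of count V. [folklore] -/
def segsT' (K : PropForm ℕ) : List (List (PropForm ℕ)) :=
  [[ctx (d.KT' K) (var (d.M₃.ge d.L))],
   Logic.weakLines K (neg (var (d.M₃.ge d.L))) d.wkT',
   (List.range d.L).map (fun i => ctx (d.KT' K) (eqv (d.y1V i) (d.E1.d d.L i))),
   [ctx (d.KT' K) (var d.g₁)],
   (List.range d.L).map (fun i => ctx (d.KT' K) (eqv (d.y1s i) (d.E1.d d.L i))),
   (List.range d.L).map (fun i => ctx (d.KT' K) (eqv (d.y1V i) (d.y1s i))),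
   Adder.reflLines (d.KT' K) ((List.range d.L).map d.n),
   Sub.leibLines d.E2V d.E2s (d.KT' K) d.L,
   [ctx (d.KT' K) (eqv (d.M₄.ge d.L) d.g₂)],
   [ctx (d.KT' K) (Adder.invF (var (d.M₃.ge d.L)) (var (d.M₄.ge d.L)) (var d.g₁) (var d.g₂))]]

/-- **Count V, positive branch**: under `ge₃`, `g₁` holds (system `G1L`), `y1V ≡ E1.d ≡ y1s`,
`E2V ≡ E2s`, so `ge₄ ↔ g₂` and `ge₃ + ge₄ = g₁ + g₂`. [cite: CookReckhow1979, §2] -/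
theorem isBlock_segsT' (hG : ∀ r ∈ assocRules, r ∈ G.rules) (hGN : ∀ r ∈ Netlist.rules, r ∈ G.rules)
    (hGA : ∀ r ∈ Adder.rules, r ∈ G.rules) (hGL : ∀ r ∈ Logic.rules, r ∈ G.rules)
    (hGG : ∀ r ∈ glueRules, r ∈ G.rules) {T : Set (PropForm ℕ)} (h : d.Avail K T)
    (hinv : G1L.line K d.actG1L d.L ∈ T) (hY : ctx K (neg (var (d.AU.c d.L))) ∈ T)
    (hge : ctx K (eqv (d.M₄.ge d.L) (d.E2V.ge d.L d.L)) ∈ T) : G.IsBlock T (d.segsT' K).flatten := by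
  have hwk : ∀ θ ∈ d.wkT', ctx K θ ∈ T := by
    intro θ hθ
    simp only [wkT', List.mem_append, List.mem_cons, List.not_mem_nil, or_false] at hθ
    rcases hθ with (rfl | rfl | rfl) | hθ | hθ | hθ | hθ
    · exact hinv
    · exact hY
    · exact hge
    · obtain ⟨i, hi, rfl⟩ := List.mem_map.1 hθ; exact h.hy1V i (List.mem_range.1 hi)
    · obtain ⟨i, hi, rfl⟩ := List.mem_map.1 hθ; exact h.hy1s i (List.mem_range.1 hi)
    · exact forall_of_subAvail h.hE2V θ hθ
    · exact forall_of_subAvail h.hE2s θ hθ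
  have w₁ : ∀ {i}, i < d.L → muxLine (d.y1V i) (d.M₃.ge d.L) (d.E1.d d.L i) (d.Y.s i) ∈ d.wkT' := fun hi =>
    List.mem_append_right _ (List.mem_append_left _ (mem_muxDefList hi))
  have w₂ : ∀ {i}, i < d.L → muxLine (d.y1s i) d.g₁ (d.E1.d d.L i) (d.Y.s i) ∈ d.wkT' := fun hi =>
    List.mem_append_right _ (List.mem_append_right _ (List.mem_append_left _ (mem_muxDefList hi)))
  have w₃ : ∀ θ ∈ subDefList d.E2V d.L, θ ∈ d.wkT' := fun θ hθ =>
    List.mem_append_right _ (List.mem_append_right _ (List.mem_append_right _ (List.mem_append_left _ hθ)))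
  have w₄ : ∀ θ ∈ subDefList d.E2s d.L, θ ∈ d.wkT' := fun θ hθ =>
    List.mem_append_right _ (List.mem_append_right _ (List.mem_append_right _ (List.mem_append_right _ hθ)))
  refine isBlock_flatten _ fun k hk => ?_
  simp only [segsT', List.length_cons, List.length_nil] at hk
  -- abbreviation for the growing set
  have mem : ∀ {χ} (j : ℕ) (hj : j < k) (hχ : χ ∈ (d.segsT' K)[j]'(by simp [segsT']; omega)),
      χ ∈ T ∪ {χ | ∃ j, ∃ hj : j < k, χ ∈ (d.segsT' K)[j]'(by simp [segsT']; omega)} := fun j hj hχ => Or.inr ⟨j, hj, hχ⟩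
  have k₀ : inst (d.actG1L d.L) G1L.inv ∈ d.wkT' := List.mem_append_left _ (List.mem_cons.2 (Or.inl rfl))
  have k₁ : inst (d.actG1L d.L) (neg (var 2)) ∈ d.wkT' :=
    List.mem_append_left _ (List.mem_cons.2 (Or.inr (List.mem_cons.2 (Or.inl rfl))))
  have k₂ : eqv (d.M₄.ge d.L) (d.E2V.ge d.L d.L) ∈ d.wkT' :=
    List.mem_append_left _ (List.mem_cons.2 (Or.inr (List.mem_cons.2 (Or.inr (List.mem_cons.2 (Or.inl rfl))))))
  interval_cases k
  · -- 0: the case hypothesis `ge₃`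
    exact FregeSystem.IsBlock.singleton (Or.inr (Logic.infer hGL 1 (by decide)
      (FregeSystem.sub [K, var (d.M₃.ge d.L)]) rfl FregeSystem.prems_nil))
  · -- 1: weakening
    exact Logic.isBlock_weakLines hGL K _ fun L hL => Or.inl (hwk L hL)
  · -- 2: `y1V ≡ E1.d`
    refine Scaffold.isBlock_of_forall fun θ hθ => ?_
    obtain ⟨i, hi, rfl⟩ := List.mem_map.1 hθ
    rw [List.mem_range] at hi
    exact Or.inr (Logic.infer hGL 13 (by decide)
      (FregeSystem.sub [d.KT' K, var (d.y1V i), var (d.M₃.ge d.L), var (d.E1.d d.L i), var (d.Y.s i)]) rfl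
      (FregeSystem.prems_cons (mem 1 (by omega) (Logic.mem_weakLines (w₁ hi)))
        (FregeSystem.prems_cons (mem 0 (by omega) (List.mem_singleton_self _)) FregeSystem.prems_nil)))
  · -- 3: `g₁` by the end rule of `G1L`
    exact FregeSystem.IsBlock.singleton (Or.inr (System.isInferredFrom_end assocLeavesOK.2.2.2.2.2.2.2.inv_ne_zero
      (hG _ (mem_assocRules (i := 23) (by decide))) (System.forall_ne_zero_of_shapesOKB (by decide +kernel))
      (ne_zero_of_allVarsB (by decide +kernel)) (d.KT' K) d.actG1L d.L
      (mem 1 (by omega) (Logic.mem_weakLines k₀)) fun φ hφ => by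
        simp only [List.mem_cons, List.not_mem_nil, or_false] at hφ
        rcases hφ with rfl | rfl
        exacts [mem 0 (by omega) (List.mem_singleton_self _), mem 1 (by omega) (Logic.mem_weakLines k₁)]))
  · -- 4: `y1s ≡ E1.d`
    refine Scaffold.isBlock_of_forall fun θ hθ => ?_
    obtain ⟨i, hi, rfl⟩ := List.mem_map.1 hθ
    rw [List.mem_range] at hi
    exact Or.inr (Logic.infer hGL 13 (by decide)
      (FregeSystem.sub [d.KT' K, var (d.y1s i), var d.g₁, var (d.E1.d d.L i), var (d.Y.s i)]) rfl
      (FregeSystem.prems_cons (mem 1 (by omega) (Logic.mem_weakLines (w₂ hi)))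
        (FregeSystem.prems_cons (mem 3 (by omega) (List.mem_singleton_self _)) FregeSystem.prems_nil)))
  · -- 5: `y1V ≡ y1s`
    refine Scaffold.isBlock_of_forall fun θ hθ => ?_
    obtain ⟨i, hi, rfl⟩ := List.mem_map.1 hθ
    rw [List.mem_range] at hi
    exact Or.inr (glue hGG 2 (by decide) (FregeSystem.sub [d.KT' K, var (d.y1V i), var (d.E1.d d.L i), var (d.y1s i)]) rfl
      (FregeSystem.prems_cons (mem 2 (by omega) (List.mem_map.2 ⟨i, List.mem_range.2 hi, rfl⟩))
        (FregeSystem.prems_cons (mem 4 (by omega) (List.mem_map.2 ⟨i, List.mem_range.2 hi, rfl⟩)) FregeSystem.prems_nil)))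
  · -- 6: reflexivity of `n`
    exact Adder.isBlock_reflLines hGA _ _ _
  · -- 7: `E2V ≡ E2s`
    exact Sub.isBlock_leibLines hGN hGL _ _
      (subAvail_of_forall fun θ hθ => mem 1 (by omega) (Logic.mem_weakLines (w₃ θ hθ)))
      (subAvail_of_forall fun θ hθ => mem 1 (by omega) (Logic.mem_weakLines (w₄ θ hθ)))
      (fun i hi => mem 5 (by omega) (List.mem_map.2 ⟨i, List.mem_range.2 hi, rfl⟩))
      (fun i hi => mem 6 (by omega) (Adder.mem_reflLines (List.mem_map.2 ⟨i, List.mem_range.2 hi, rfl⟩)))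
  · -- 8: `ge₄ ↔ g₂`
    exact FregeSystem.IsBlock.singleton (Or.inr (Logic.infer hGL 6 (by decide)
      (FregeSystem.sub [d.KT' K, var (d.M₄.ge d.L), var (d.E2V.ge d.L d.L), var d.g₂]) rfl
      (FregeSystem.prems_cons (mem 1 (by omega) (Logic.mem_weakLines k₂))
        (FregeSystem.prems_cons (mem 7 (by omega) (Sub.mem_leibLines (k := 2 * d.L) (by omega))) FregeSystem.prems_nil))))
  · -- 9: counting
    exact FregeSystem.IsBlock.singleton (Or.inr (glue hGG 4 (by decide)
      (FregeSystem.sub [d.KT' K, var (d.M₃.ge d.L), var (d.M₄.ge d.L), var d.g₁, var d.g₂]) rfl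
      (FregeSystem.prems_cons (mem 0 (by omega) (List.mem_singleton_self _))
        (FregeSystem.prems_cons (mem 3 (by omega) (List.mem_singleton_self _))
        (FregeSystem.prems_cons (mem 8 (by omega) (List.mem_singleton_self _)) FregeSystem.prems_nil)))))

/-- The lines weakened into the negative branch. [folklore] -/
def wkF' : List (PropForm ℕ) :=
  [inst (d.actNG2L d.L) NG2L.inv, neg (var (d.A.ge d.L d.L)), eqv (d.M₄.ge d.L) (d.E2V.ge d.L d.L)] ++
    (muxDefList d.y1V (d.M₃.ge d.L) (d.E1.d d.L) d.Y.s d.L ++ (subDefList d.E2V d.L ++ subDefList d.E1 d.L))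

/-- The segments of the negative branch of count V. [folklore] -/
def segsF' (K : PropForm ℕ) : List (List (PropForm ℕ)) :=
  [[ctx (d.KF' K) (neg (var (d.M₃.ge d.L)))],
   Logic.weakLines K (var (d.M₃.ge d.L)) d.wkF',
   (List.range d.L).map (fun i => ctx (d.KF' K) (eqv (d.y1V i) (d.Y.s i))),
   Adder.reflLines (d.KF' K) ((List.range d.L).map d.n ++ [d.g₁]),
   Sub.leibLines d.E2V d.E1 (d.KF' K) d.L,
   [ctx (d.KF' K) (eqv (d.M₄.ge d.L) d.g₁)],
   [ctx (d.KF' K) (neg (var d.g₂))],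
   [ctx (d.KF' K) (Adder.invF (var (d.M₃.ge d.L)) (var (d.M₄.ge d.L)) (var d.g₁) (var d.g₂))]]

/-- **Count V, negative branch**: under `¬ge₃`, `y1V ≡ Y`, `E2V ≡ E1`, so `ge₄ ↔ g₁`; `¬g₂` by the
end rule of `NG2L`; hence `ge₃ + ge₄ = g₁ + g₂`. [cite: CookReckhow1979, §2] -/
theorem isBlock_segsF' (hG : ∀ r ∈ assocRules, r ∈ G.rules) (hGN : ∀ r ∈ Netlist.rules, r ∈ G.rules)
    (hGA : ∀ r ∈ Adder.rules, r ∈ G.rules) (hGL : ∀ r ∈ Logic.rules, r ∈ G.rules)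
    (hGG : ∀ r ∈ glueRules, r ∈ G.rules) {T : Set (PropForm ℕ)} (h : d.Avail K T)
    (hinv : NG2L.line K d.actNG2L d.L ∈ T) (hC : ctx K (neg (var (d.A.ge d.L d.L))) ∈ T)
    (hge : ctx K (eqv (d.M₄.ge d.L) (d.E2V.ge d.L d.L)) ∈ T) : G.IsBlock T (d.segsF' K).flatten := by
  have hwk : ∀ θ ∈ d.wkF', ctx K θ ∈ T := by
    intro θ hθ
    simp only [wkF', List.mem_append, List.mem_cons, List.not_mem_nil, or_false] at hθ
    rcases hθ with (rfl | rfl | rfl) | hθ | hθ | hθ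
    · exact hinv
    · exact hC
    · exact hge
    · obtain ⟨i, hi, rfl⟩ := List.mem_map.1 hθ; exact h.hy1V i (List.mem_range.1 hi)
    · exact forall_of_subAvail h.hE2V θ hθ
    · exact forall_of_subAvail h.hE1 θ hθ
  have w₁ : ∀ {i}, i < d.L → muxLine (d.y1V i) (d.M₃.ge d.L) (d.E1.d d.L i) (d.Y.s i) ∈ d.wkF' := fun hi =>
    List.mem_append_right _ (List.mem_append_left _ (mem_muxDefList hi))
  have w₃ : ∀ θ ∈ subDefList d.E2V d.L, θ ∈ d.wkF' := fun θ hθ =>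
    List.mem_append_right _ (List.mem_append_right _ (List.mem_append_left _ hθ))
  have w₄ : ∀ θ ∈ subDefList d.E1 d.L, θ ∈ d.wkF' := fun θ hθ =>
    List.mem_append_right _ (List.mem_append_right _ (List.mem_append_right _ hθ))
  refine isBlock_flatten _ fun k hk => ?_
  simp only [segsF', List.length_cons, List.length_nil] at hk
  have mem : ∀ {χ} (j : ℕ) (hj : j < k) (hχ : χ ∈ (d.segsF' K)[j]'(by simp [segsF']; omega)),
      χ ∈ T ∪ {χ | ∃ j, ∃ hj : j < k, χ ∈ (d.segsF' K)[j]'(by simp [segsF']; omega)} := fun j hj hχ => Or.inr ⟨j, hj, hχ⟩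
  have k₀ : inst (d.actNG2L d.L) NG2L.inv ∈ d.wkF' := List.mem_append_left _ (List.mem_cons.2 (Or.inl rfl))
  have k₁ : inst (d.actNG2L d.L) (neg (var 1)) ∈ d.wkF' :=
    List.mem_append_left _ (List.mem_cons.2 (Or.inr (List.mem_cons.2 (Or.inl rfl))))
  have k₂ : eqv (d.M₄.ge d.L) (d.E2V.ge d.L d.L) ∈ d.wkF' :=
    List.mem_append_left _ (List.mem_cons.2 (Or.inr (List.mem_cons.2 (Or.inr (List.mem_cons.2 (Or.inl rfl))))))
  interval_cases k
  · -- 0: the case hypothesis `¬ge₃`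
    exact FregeSystem.IsBlock.singleton (Or.inr (Logic.infer hGL 2 (by decide)
      (FregeSystem.sub [K, var (d.M₃.ge d.L)]) rfl FregeSystem.prems_nil))
  · -- 1: weakening
    exact Logic.isBlock_weakLines hGL K _ fun L hL => Or.inl (hwk L hL)
  · -- 2: `y1V ≡ Y`
    refine Scaffold.isBlock_of_forall fun θ hθ => ?_
    obtain ⟨i, hi, rfl⟩ := List.mem_map.1 hθ
    rw [List.mem_range] at hi
    exact Or.inr (Logic.infer hGL 14 (by decide)
      (FregeSystem.sub [d.KF' K, var (d.y1V i), var (d.M₃.ge d.L), var (d.E1.d d.L i), var (d.Y.s i)]) rfl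
      (FregeSystem.prems_cons (mem 1 (by omega) (Logic.mem_weakLines (w₁ hi)))
        (FregeSystem.prems_cons (mem 0 (by omega) (List.mem_singleton_self _)) FregeSystem.prems_nil)))
  · -- 3: reflexivity of `n` and `g₁`
    exact Adder.isBlock_reflLines hGA _ _ _
  · -- 4: `E2V ≡ E1`
    exact Sub.isBlock_leibLines hGN hGL _ _
      (subAvail_of_forall fun θ hθ => mem 1 (by omega) (Logic.mem_weakLines (w₃ θ hθ)))
      (subAvail_of_forall fun θ hθ => mem 1 (by omega) (Logic.mem_weakLines (w₄ θ hθ)))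
      (fun i hi => mem 2 (by omega) (List.mem_map.2 ⟨i, List.mem_range.2 hi, rfl⟩))
      (fun i hi => mem 3 (by omega) (Adder.mem_reflLines (List.mem_append_left _
        (List.mem_map.2 ⟨i, List.mem_range.2 hi, rfl⟩))))
  · -- 5: `ge₄ ↔ g₁`
    exact FregeSystem.IsBlock.singleton (Or.inr (Logic.infer hGL 6 (by decide)
      (FregeSystem.sub [d.KF' K, var (d.M₄.ge d.L), var (d.E2V.ge d.L d.L), var d.g₁]) rfl
      (FregeSystem.prems_cons (mem 1 (by omega) (Logic.mem_weakLines k₂))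
        (FregeSystem.prems_cons (mem 4 (by omega) (Sub.mem_leibLines (k := 2 * d.L) (by omega))) FregeSystem.prems_nil))))
  · -- 6: `¬g₂` by the end rule of `NG2L`
    exact FregeSystem.IsBlock.singleton (Or.inr (System.isInferredFrom_end assocLeavesOK.2.2.2.2.2.1.inv_ne_zero
      (hG _ (mem_assocRules (i := 17) (by decide))) (System.forall_ne_zero_of_shapesOKB (by decide +kernel))
      (ne_zero_of_allVarsB (by decide +kernel)) (d.KF' K) d.actNG2L d.L
      (mem 1 (by omega) (Logic.mem_weakLines k₀)) fun φ hφ => by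
        simp only [List.mem_cons, List.not_mem_nil, or_false] at hφ
        rcases hφ with rfl | rfl | rfl
        exacts [mem 1 (by omega) (Logic.mem_weakLines k₁), mem 0 (by omega) (List.mem_singleton_self _),
          mem 3 (by omega) (Adder.mem_reflLines (List.mem_append_right _ (List.mem_singleton_self _)))]))
  · -- 7: counting
    exact FregeSystem.IsBlock.singleton (Or.inr (glue hGG 3 (by decide)
      (FregeSystem.sub [d.KF' K, var (d.M₃.ge d.L), var (d.M₄.ge d.L), var d.g₁, var d.g₂]) rfl
      (FregeSystem.prems_cons (mem 0 (by omega) (List.mem_singleton_self _))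
        (FregeSystem.prems_cons (mem 5 (by omega) (List.mem_singleton_self _))
        (FregeSystem.prems_cons (mem 6 (by omega) (List.mem_singleton_self _)) FregeSystem.prems_nil)))))

/-- The lines of count V: both branches, then the merged count. [folklore] -/
def countV (K : PropForm ℕ) : List (PropForm ℕ) :=
  (d.segsT' K).flatten ++ (d.segsF' K).flatten ++
    Logic.mergeLines K [Adder.invF (var (d.M₃.ge d.L)) (var (d.M₄.ge d.L)) (var d.g₁) (var d.g₂)]

/-- **Count V**: `ge₃ + ge₄ = g₁ + g₂`. [cite: CookReckhow1979, §2] -/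
theorem isBlock_countV (hG : ∀ r ∈ assocRules, r ∈ G.rules) (hGN : ∀ r ∈ Netlist.rules, r ∈ G.rules)
    (hGA : ∀ r ∈ Adder.rules, r ∈ G.rules) (hGL : ∀ r ∈ Logic.rules, r ∈ G.rules)
    (hGG : ∀ r ∈ glueRules, r ∈ G.rules) {T : Set (PropForm ℕ)} (h : d.Avail K T)
    (hinv₁ : G1L.line K d.actG1L d.L ∈ T) (hinv₂ : NG2L.line K d.actNG2L d.L ∈ T) (hY : ctx K (neg (var (d.AU.c d.L))) ∈ T)
    (hC : ctx K (neg (var (d.A.ge d.L d.L))) ∈ T) (hge : ctx K (eqv (d.M₄.ge d.L) (d.E2V.ge d.L d.L)) ∈ T) :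
    G.IsBlock T (d.countV K) := by
  refine Logic.isBlock_cases (A := var (d.M₃.ge d.L)) hGL (d.isBlock_segsT' hG hGN hGA hGL hGG h hinv₁ hY hge)
    ((d.isBlock_segsF' hG hGN hGA hGL hGG h hinv₂ hC hge).mono Set.subset_union_left) (fun L hL => ?_) fun L hL => ?_
  · rw [List.mem_singleton.1 hL]
    refine Or.inl (Or.inr ?_)
    simp only [Set.mem_setOf_eq, segsT', List.flatten_cons, List.flatten_nil, List.mem_append, List.mem_singleton]
    exact Or.inr (Or.inr (Or.inr (Or.inr (Or.inr (Or.inr (Or.inr (Or.inr (Or.inr (Or.inl rfl)))))))))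
  · rw [List.mem_singleton.1 hL]
    refine Or.inr ?_
    simp only [Set.mem_setOf_eq, segsF', List.flatten_cons, List.flatten_nil, List.mem_append, List.mem_singleton]
    exact Or.inr (Or.inr (Or.inr (Or.inr (Or.inr (Or.inr (Or.inr (Or.inl rfl)))))))

/-- The conclusion of count V. [folklore] -/
theorem mem_countV : ctx K (Adder.invF (var (d.M₃.ge d.L)) (var (d.M₄.ge d.L)) (var d.g₁) (var d.g₂)) ∈ d.countV K :=
  List.mem_append_right _ (List.mem_singleton_self _)

/-! ### Sub-block 4: `wT ≡ wV` (system `B4`, needs validity) -/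

/-- Leaf assignment of `B4`. [folklore] -/
def actB4 (i : ℕ) (k : ℕ) : ℕ :=
  [0, d.E1.ge d.L i, d.E2T.ge d.L i, d.E2V.ge d.L i, d.M₁.ge d.L, d.M₂.ge d.L, d.M₃.ge d.L, d.M₄.ge d.L, d.Y.s i, d.n i,
    d.E1.ny i, d.E1.d d.L i, d.E1.ge d.L (i + 1), d.y1T i, d.E2T.ny i, d.E2T.d d.L i, d.E2T.ge d.L (i + 1), d.wT i,
    d.y1V i, d.E2V.ny i, d.E2V.d d.L i, d.E2V.ge d.L (i + 1), d.wV i].getD k 0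

/-- The lines of sub-block 4. [folklore] -/
def sb4 (K : PropForm ℕ) : List (PropForm ℕ) := posBlock B4 K d.actB4 d.L (biimp (var 17) (var 22))

/-- The validity line `ge₁ + ge₂ = ge₃ + ge₄`. [folklore] -/
def validLine : PropForm ℕ := Adder.invF (var (d.M₁.ge d.L)) (var (d.M₂.ge d.L)) (var (d.M₃.ge d.L)) (var (d.M₄.ge d.L))

/-- Availability of the shapes of `B4`. [folklore] -/
theorem availB4 {T : Set (PropForm ℕ)} (h : d.Avail K T) : ∀ i < d.L, ∀ φ ∈ B4.shapes, ctx K (inst (d.actB4 i) φ) ∈ T := by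
  intro i hi φ hφ
  simp only [B4, List.mem_cons, List.not_mem_nil, or_false] at hφ
  rcases hφ with rfl | rfl | rfl | rfl | rfl | rfl | rfl | rfl | rfl | rfl | rfl | rfl | rfl
  exacts [h.hE1.1 i hi, (h.hE1.2.2 i hi).1, (h.hE1.2.2 i hi).2, h.hy1T i hi, h.hE2T.1 i hi, (h.hE2T.2.2 i hi).1,
    (h.hE2T.2.2 i hi).2, h.hwT i hi, h.hy1V i hi, h.hE2V.1 i hi, (h.hE2V.2.2 i hi).1, (h.hE2V.2.2 i hi).2, h.hwV i hi]

/-- **Sub-block 4**: with the validity line available, `wT ≡ wV` bitwise. [cite: CookReckhow1979, §2] -/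
theorem isBlock_sb4 (hG : ∀ r ∈ assocRules, r ∈ G.rules) {T : Set (PropForm ℕ)} (h : d.Avail K T)
    (hv : ctx K d.validLine ∈ T) : G.IsBlock T (d.sb4 K) :=
  isBlock_posBlock assocLeavesOK.2.2.2.1 (hG _ (mem_assocRules (i := 9) (by decide)))
    (hG _ (mem_assocRules (i := 10) (by decide))) (hG _ (mem_assocRules (i := 11) (by decide)))
    (fun φ hφ => by
      rcases List.mem_cons.1 hφ with rfl | hφ
      · exact ne_zero_of_allVarsB (by decide +kernel)
      · exact assocLeavesOK.2.2.2.1.2.1 φ hφ)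
    (ne_zero_of_allVarsB (by decide +kernel)) K d.actB4 d.L
    (hcoh_of (p := fun k => decide (1 ≤ k ∧ k ≤ 7)) (by decide +kernel) fun i _ k hk => by
      simp only [decide_eq_true_eq] at hk
      obtain ⟨hk₁, hk₂⟩ := hk
      interval_cases k <;> rfl)
    (fun φ hφ => by
      simp only [B4, List.mem_cons, List.not_mem_nil, or_false] at hφ
      rcases hφ with rfl | rfl | rfl
      exacts [h.hE1.2.1, h.hE2T.2.1, h.hE2V.2.1])
    (d.availB4 h) fun i hi φ hφ => by
      rcases List.mem_cons.1 hφ with rfl | hφ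
      · exact hv
      · exact d.availB4 h i hi φ hφ

/-- Conclusions of sub-block 4. [folklore] -/
theorem mem_sb4 {i : ℕ} (hi : i < d.L) : ctx K (eqv (d.wT i) (d.wV i)) ∈ d.sb4 K := mem_posBlock hi

/-! ### The associativity law -/

/-- The segments of the associativity law. [folklore] -/
def segs (K : PropForm ℕ) : List (List (PropForm ℕ)) :=
  [Adder.reflLines K ((List.range d.L).map d.n ++ [d.M₂.ge d.L, d.M₃.ge d.L, d.M₄.ge d.L]),
   d.sb1 K, d.sb2 K, d.sb3 K, d.chainT K, d.chainV K,
   NG2.lines K d.actNG2 d.L, G1.lines K d.actG1 d.L, NG2L.lines K d.actNG2L d.L, G1L.lines K d.actG1L d.L,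
   d.bookLines K, d.countT K, d.countV K, [ctx K d.validLine], d.sb4 K,
   (List.range d.L).map (fun i => ctx K (eqv (d.tp i) (d.wV i))),
   (List.range d.L).map (fun i => ctx K (eqv (d.tp i) (d.vp i)))]

/-- The lines of the associativity law. [folklore] -/
def lines (K : PropForm ℕ) : List (PropForm ℕ) := (d.segs K).flatten

/-- **Associativity of modular addition inside Frege.** For four modular adders
`M₁ = a ⊕ b`, `M₂ = M₁ ⊕ c`, `M₃ = b ⊕ c`, `M₄ = a ⊕ M₃` of width `L` on words whose bits are
provably false from position `m` on (`m + 2 ≤ L`), with `a < n` and `c < n` (comparator facts)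
and the scratch circuits of `AssocData` available, the outputs of `M₂` and `M₄` are
provably equal bit by bit: `(a ⊕ b) ⊕ c = a ⊕ (b ⊕ c)`. The proof is position-uniform: eight
carry inductions with machine-found invariants, Leibniz glue, and two binary case splits for
the count `ge₁ + ge₂ = ge₃ + ge₄` of performed reductions. [cite: CookReckhow1979, §2] -/
theorem isBlock_lines (hG : ∀ r ∈ assocRules, r ∈ G.rules) (hGN : ∀ r ∈ Netlist.rules, r ∈ G.rules)
    (hGA : ∀ r ∈ Adder.rules, r ∈ G.rules) (hGL : ∀ r ∈ Logic.rules, r ∈ G.rules)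
    (hGG : ∀ r ∈ glueRules, r ∈ G.rules) (h : d.Avail K Γ) {m : ℕ} (hm : m + 2 ≤ d.L)
    (haf : ∀ i, m ≤ i → i < d.L → ctx K (neg (var (d.a i))) ∈ Γ)
    (hbf : ∀ i, m ≤ i → i < d.L → ctx K (neg (var (d.b i))) ∈ Γ)
    (hcf : ∀ i, m ≤ i → i < d.L → ctx K (neg (var (d.c i))) ∈ Γ)
    (hA : ctx K (neg (var (d.A.ge d.L d.L))) ∈ Γ) (hC : ctx K (neg (var (d.C.ge d.L d.L))) ∈ Γ) :
    G.IsBlock Γ (d.lines K) := by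
  refine isBlock_flatten _ fun k hk => ?_
  simp only [segs, List.length_cons, List.length_nil] at hk
  have mem : ∀ {χ} (j : ℕ) (hj : j < k) (hχ : χ ∈ (d.segs K)[j]'(by simp [segs]; omega)),
      χ ∈ Γ ∪ {χ | ∃ j, ∃ hj : j < k, χ ∈ (d.segs K)[j]'(by simp [segs]; omega)} := fun j hj hχ => Or.inr ⟨j, hj, hχ⟩
  have hΓ : Γ ⊆ Γ ∪ {χ | ∃ j, ∃ hj : j < k, χ ∈ (d.segs K)[j]'(by simp [segs]; omega)} := fun _ hχ => Or.inl hχ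
  have hn : 0 < k → ∀ i < d.L,
      ctx K (eqv (d.n i) (d.n i)) ∈ Γ ∪ {χ | ∃ j, ∃ hj : j < k, χ ∈ (d.segs K)[j]'(by simp [segs]; omega)} :=
    fun hk' i hi => Or.inr ⟨0, hk', Adder.mem_reflLines (List.mem_append_left _ (List.mem_map.2
      ⟨i, List.mem_range.2 hi, rfl⟩))⟩
  have hges : 0 < k → ∀ x ∈ [d.M₂.ge d.L, d.M₃.ge d.L, d.M₄.ge d.L],
      ctx K (eqv x x) ∈ Γ ∪ {χ | ∃ j, ∃ hj : j < k, χ ∈ (d.segs K)[j]'(by simp [segs]; omega)} :=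
    fun hk' x hx => Or.inr ⟨0, hk', Adder.mem_reflLines (List.mem_append_right _ hx)⟩
  interval_cases k
  · exact Adder.isBlock_reflLines hGA _ _ _
  · exact d.isBlock_sb1 hG (h.mono hΓ)
  · exact d.isBlock_sb2 hG (h.mono hΓ)
  · exact d.isBlock_sb3 hG (h.mono hΓ)
  · exact d.isBlock_chainT hGN hGL (h.mono hΓ) (fun i hi => mem 1 (by omega) (d.mem_sb1 hi)) (hn (by omega))
      (hges (by omega) _ (by simp))
  · exact d.isBlock_chainV hGN hGL hGG (h.mono hΓ) (fun i hi => mem 2 (by omega) (d.mem_sb2 hi))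
      (fun i hi => mem 3 (by omega) (d.mem_sb3 hi)) (hn (by omega)) (hges (by omega) _ (by simp)) (hges (by omega) _ (by simp))
  · exact d.isBlock_sb5 hG (h.mono hΓ)
  · exact d.isBlock_sb6 hG (h.mono hΓ)
  · exact d.isBlock_sb7 hG (h.mono hΓ) fun i hi => mem 3 (by omega) (d.mem_sb3 hi)
  · exact d.isBlock_sb8 hG (h.mono hΓ) fun i hi => mem 3 (by omega) (d.mem_sb3 hi)
  · exact d.isBlock_bookLines hGG (h.mono hΓ) hm (fun i h₁ h₂ => hΓ (haf i h₁ h₂)) (fun i h₁ h₂ => hΓ (hbf i h₁ h₂))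
      fun i h₁ h₂ => hΓ (hcf i h₁ h₂)
  · exact d.isBlock_countT hG hGN hGA hGL hGG (h.mono hΓ) (mem 7 (by omega) (System.mem_lines G1 K d.actG1 le_rfl))
      (mem 6 (by omega) (System.mem_lines NG2 K d.actNG2 le_rfl)) (mem 10 (by omega) d.mem_bookLines.1) (hΓ hC)
      (mem 4 (by omega) d.ge_mem_chainT)
  · exact d.isBlock_countV hG hGN hGA hGL hGG (h.mono hΓ) (mem 9 (by omega) (System.mem_lines G1L K d.actG1L le_rfl))
      (mem 8 (by omega) (System.mem_lines NG2L K d.actNG2L le_rfl)) (mem 10 (by omega) d.mem_bookLines.2) (hΓ hA)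
      (mem 5 (by omega) d.ge_mem_chainV)
  · exact FregeSystem.IsBlock.singleton (Or.inr (glue hGG 5 (by decide)
      (FregeSystem.sub [K, var (d.M₁.ge d.L), var (d.M₂.ge d.L), var (d.M₃.ge d.L), var (d.M₄.ge d.L), var d.g₁, var d.g₂])
      rfl (FregeSystem.prems_cons (mem 11 (by omega) d.mem_countT) (FregeSystem.prems_cons (mem 12 (by omega) d.mem_countV)
        FregeSystem.prems_nil))))
  · exact d.isBlock_sb4 hG (h.mono hΓ) (mem 13 (by omega) (List.mem_singleton_self _))
  · refine Scaffold.isBlock_of_forall fun θ hθ => ?_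
    obtain ⟨i, hi, rfl⟩ := List.mem_map.1 hθ
    rw [List.mem_range] at hi
    exact Or.inr (Logic.infer hGL 6 (by decide) (FregeSystem.sub [K, var (d.tp i), var (d.wT i), var (d.wV i)]) rfl
      (FregeSystem.prems_cons (mem 4 (by omega) (d.tp_mem_chainT hi))
        (FregeSystem.prems_cons (mem 14 (by omega) (d.mem_sb4 hi)) FregeSystem.prems_nil)))
  · refine Scaffold.isBlock_of_forall fun θ hθ => ?_
    obtain ⟨i, hi, rfl⟩ := List.mem_map.1 hθ
    rw [List.mem_range] at hi
    exact Or.inr (glue hGG 2 (by decide) (FregeSystem.sub [K, var (d.tp i), var (d.wV i), var (d.vp i)]) rfl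
      (FregeSystem.prems_cons (mem 15 (by omega) (List.mem_map.2 ⟨i, List.mem_range.2 hi, rfl⟩))
        (FregeSystem.prems_cons (mem 5 (by omega) (d.vp_mem_chainV hi)) FregeSystem.prems_nil)))

/-- **The conclusion of associativity**: `((a ⊕ b) ⊕ c)ᵢ ↔ (a ⊕ (b ⊕ c))ᵢ` for `i < L`. [folklore] -/
theorem mem_lines {i : ℕ} (hi : i < d.L) : ctx K (eqv (d.tp i) (d.vp i)) ∈ d.lines K := by
  simp only [lines, segs, List.flatten_cons, List.flatten_nil, List.mem_append, List.append_nil]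
  repeat' first | exact Or.inr (List.mem_map.2 ⟨i, List.mem_range.2 hi, rfl⟩) | refine Or.inr ?_

end AssocData

end ModAddU

end Literature.Computability.MetaComplexity
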